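/-
Copyright: cell `langlands-arthur-audit` (papers/Langlands/langlands-arthur-audit), unit `pub-arthur-down-g54`
(downstream tracer, gen 54).  Thirty-sixth file of the downstream register (module M261 of the cell's MODULE-MAP, CLAIMed in `lean/MODULE-MAP3.md`
2026-08-24 — the third volume of the map, opened by this unit because `lean/MODULE-MAP2.md` stood at 98 % of its 1 MiB mirror cap; M255 – M260 are the
TYPER line's `Leaves/…InPrint….lean` modules).  `Downstream.lean` (tranches 1–4) … `Downstream35.lean` (118–124, module M254, FULL at 199 kB) hold the register
so far; this file continues it, APPEND-ONLY in the same conventions and the same namespace `…Arthur2013.Downstream`.  v1 imports `…Downstream33` — a SIBLING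
of `…Downstream34` / `…Downstream35`, not their successor in the import chain: on 2026-08-24 the hub's olean store for this library is frozen at
2026-08-23T20:41Z (ops-buildfix B18-3) and the farm serves `…Downstream34` / `…Downstream35` in a SUPERSEDED state (this unit's probe, 15:05Z–15:07Z:
`import …Downstream35` elaborates but knows `Consumers118` only — `Consumers119` … `Consumers124` « Unknown identifier », i.e. v1 of eight versions;
`import …Downstream34` knows `Consumers115` but not `Consumers117`, i.e. pre-v3), so a file importing either would elaborate against stale content;
`Downstream33.lean` (unchanged since 2026-08-23T10:15Z) elaborates with its current content, and through it everything this tranche uses: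
`…Downstream13` (tranches 53 – 54: `Consumers53.MRunitaryReal` / `MRsymmetric`, `Implications53`, `mrUnitaryReal_of_inputs`, `Consumers54.MoeglinImage`),
`…Downstream18` (tranche 69: `Consumers69.ZhuHyp202` / `ZhuOrthogonalIH`, `Implications69`), `…Downstream10` (tranche 41: `Consumers41.HLLZclosure`, `Implications41`), `…Downstream7`
(tranche 34: `Consumers34.HaanGGP`, `Implications34`), `…Downstream5`
(tranche 26: `Consumers26.HLL`, `Implications26`, `hll_of_leaves`), `…Downstream2` (tranches 5, 8: `Consumers5`, `Implications5`, `atobeApackets_of_leaves`,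
`atobeMinguez_of_leaves`, `Consumers8`, `Implications8`) and `…Downstream` (`BookInputs`, `MokInputs`, `KMSWInputs`, `Consumers`, `Implications`,
`taibiInner_of_leaves`, `amr_of_leaves`, `Consumers2`, `Implications2`, `xuMoeglinParam_of_leaves`) — the sibling pattern of tranche 83 (`Downstream24.lean`) and of M254 v1.  Nothing of tranches 115–124 is used here.
v1 = the hundred-and-twenty-fifth tranche (`Consumers125`: THE LATEST arXiv TEXT STATES V — the three typed follow-ups that unit `pub-arthur-down-g53`'s
by-eye pass over the 393 corpus-TeX rows scoped but did not file (cell `GAPS.md` G-DN-511 (1)) and the one it left unread (G-DN-510 (5): row C36 beyond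
`DIVERGENCE3.md` D-DN-g52-5): row B31 Hazeltine – Liu – Lo – Zhang in arXiv v2 (2024-04-05, the
final arXiv version, under the title of the article published as J. reine angew. Math. 823 (2025)) (`HLLZclosureV2`: Theorems 1.3, 1.4, 1.7, 3.15, 7.3, 7.4 — the introduction of the typed v1 rewritten, its
Theorems 1.9 / 1.12 / 1.15 / 1.16 redistributed, its §5 algorithms gone, Theorem 1.7 new; ⇐ the book ∧ rows B2, B5, B42, B101 as tranche 41 AND row C168,
whose Proposition 5.1 is v2's Theorem 2.2), row B44 Mœglin – Renard in arXiv v2 (`MRsymmetricV2`: Proposition 3.1, Corollaire 4.2, Proposition 7.3, §8 —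
for tranche 53's « Théorème 2.3 », which v2 no longer prints; ⇐ rows A8, B24 as tranche 53; version of record Rad HAZU Mat. Znan. 28 (2024) 353–403
located, an image-only scan, body not compared), and row C16 Jiang – Zhang, Ann. of Math. 191 (2020), Appendix B THEOREM B.2 = Theorem 5.1 (`JZnlio` as
printed, for the paper's pure inner forms of quasi-split unitary and special orthogonal groups ⇐ the book ∧ Mok ∧ KMSW in its proved scope ∧ the register's
Chapter-9 leaf, the premises of tranche 8's `E_JZmain`; `JZnlioU`, its unitary-group instance ⇐ Mok ∧ KMSW in its proved scope — the statement row C35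
cites in arXiv v7 as « [35, Theorem B.2] » (tranche 124's `E_HaanGGPv7` docstring), not among row C16's fields of tranche 8), and row C36 Y. Zhu in arXiv v3
= « Final revision. To appear in Astérisque » (`ZhuIHv3`: Theorems 9.7.5, 9.8.5, Lemma 9.8.3, Corollaries 9.8.8, 9.8.10 under Hypothesis 9.1.2 — the chapter's statements, of which
tranche 69 quoted the odd-n introduction theorem and « Theorem 246 » of the 2018 thesis text; the final revision adds a temperedness part, an unconditional
irreducibility lemma and a Galois–Hecke decomposition; ⇐ the book ∧ rows A3, B1 ∧ tranche 69's node `ZhuHyp202`); `Implications125`; bookkeeping theorems incl. the side-by-side theorems with tranches 41, 53, 34, 8 and 69).  Nothing of the first thirty-five files is redeclared or changed.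
v2 (same unit `pub-arthur-down-g54`) = the hundred-and-twenty-sixth tranche APPENDED (row C62 H. Peng in arXiv v4 beyond its Theorem A: `Consumers126` {`PengThmCv4`,
`PengKottwitzV4`, the hypothesis node `PengHyp458`, its Case-O / F = ℚ instance `PengHyp458OQ` ⇐ row C36's Corollary 9.8.10, `PengKottwitzSOQp`}; `Implications126`; bookkeeping
theorems; v1 untouched).  v3 (unit `pub-arthur-down-g55`, downstream tracer gen 55) = the hundred-and-twenty-seventh tranche APPENDED (THE LATEST arXiv TEXT STATES
VII — the unit's sentence-level status-drift screen over the 201 register ids with a later arXiv version: row C270 Hsieh – Yamana in arXiv v2 (`Consumers127`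
{`HYthetaV2gen`, `HYthetaV2`, node `HYmultOneD`} ⇐ the book by name ∧ row C226's Theorem 1.2 ∧ the node — tranche 105 typed the 2018 text with the nodes (JL),
(Böch), which the later text discharges in print), row C82 A. Weiss in arXiv v5 (`WeissImagesV5` ⇐ row C191 ∧ the node `WeissLiftGL4` ⇐ the book ∧ A4 — tranche 29
typed the 2018 text), and the later status wording of rows C220 (arXiv v2, its footnote 10) and C80 (arXiv v5) recorded in the tranche docstring; `Implications127`;
bookkeeping theorems incl. the two side-by-side theorems; v1 – v2 untouched).  v4 (unit `pub-arthur-down-g56`, downstream tracer gen 56) = the referee's D-REF-g219-1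
folded: the 48 doubled `pNNNN:Lx-y` locators on 24 docstring / comment lines of the tranche-127 block de-duplicated; no declaration changed (the unit's
hundred-and-twenty-eighth tranche opens `Downstream37.lean`, this file standing at 161 kB of the gate's 200 kB content cap).
-/
import HarnessLib
import Literature.NumberTheory.Automorphic.Arthur2013.Downstream33

/-!
# Downstream of Arthur (2013), Mok (2015), KMSW (2014): the typed register, thirty-sixth file (tranches ≥ 125)

**What is reproduced.**  As in the first thirty-five files: for published theorems that invoke J. Arthur, *The Endoscopic Classification of Representations* (AMS
Colloq. Publ. 61, 2013) [cite: Arthur2013], C. P. Mok's memoir [cite: Mok2012] or Kaletha – Mínguez – Shin – White [claim: KalethaMinguezShinWhite2014, under-review]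
— directly, or through typed rows of the register — one HYPOTHESIS `E_…` per statement quoting the sentences in which the paper invokes them, recording WHICH
nodes of the three dependency DAGs and of the register the proof consumes; and bookkeeping theorems composing these hypotheses with the packaged inputs
`BookInputs` / `MokInputs` / `KMSWInputs` of `Downstream.lean` and with the `…_of_leaves` / `…_of_inputs` theorems of tranches 2, 5, 26, 53.  Quotations are
exact substrings of the cell's texts staged by unit `pub-arthur-down-g53` under `HOME/pub-arthur-down-g53/primaries/` (`SHA256SUMS.index.txt` there; arXiv
PDFs fetched read-only on 2026-08-24; pNNNN.txt = PDF page, Ln = pypdf line; extraction artefacts — dropped spaces, split words, « ﬁ » ligatures — verbatim):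
`arxiv-2209.03816v2/` (row B31, arXiv v2 of 2024-04-05, 41 pp., the final arXiv version, bearing the title of the published article J. reine angew. Math. 823
(2025) 1–60 — arXiv lists no journal-ref; the version of record was NOT compared), `arxiv-1906.00725v2/` (row B44, arXiv v2 of 2023-02-24, 38 pp.; version of record: Rad Hrvat. Akad. Znan. Umjet. Mat. Znan. 28 (2024) 353–403,
doi:10.21857/moxpjhzvwm — its open PDF, fetched read-only by this unit as `vor-hazu-b44/` under `HOME/pub-arthur-down-g54/primaries/` (52 pp., sha256
13c1047f…), is an image scan whose only text layer is the repository cover page (`vor-hazu-b44/` p0001): p0001:L13 "Stranice 353 – 403" p0001:L16 "DOI DOI: 10.21857/moxpjhzvwm" p0001:L19-21 "Dio od Rad Hrvatske akademije znanosti i umjetnosti. Matematičke znanosti Svezak Sv. 28(2024)=knj. 63=knj. 558 / glavni urednik / editor-" […];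
the body was NOT compared),
`arxiv-1508.03205v4/` (row C16, arXiv v4 of 2019-11-19 = the Annals text's final arXiv version, 92 pp.; tranche 8 typed the row from the TeX source
`main.tex`, whose Appendix B is this Appendix B); and by unit `pub-arthur-down-g52` under `HOME/pub-arthur-down-g52/primaries/`: `arxiv-1801.09404v3/` (row C36, arXiv v3
of 2023-12-11, 316 pp., « Final revision. To appear in Astérisque »; Crossref doi:10.24033/ast.1225, Astérisque (SMF, 2024); the SMF volume is not open and was NOT
compared; tranche 69 typed the row from the corpus TeX of the 2018 thesis text).  Bibliography entries, title lines and every line naming a conj. are in `--` comments.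

**Why a thirty-sixth file, and why these rows (GAPS G-DN-510 / G-DN-511; `DIVERGENCE3.md` D-DN-g53-11 (f), D-DN-g53-12 (a)(b); `DOWNSTREAM5.md` Block B¹³⁵
addenda).**  M254 `Downstream35.lean` is full (99.7 % of the 200 kB per-file cap) and the store freeze forbids importing it (above).  The rows: unit
`pub-arthur-down-g53` compared, for every one of the 393 register rows typed from a corpus TeX rendering, the typed quotation with the LATEST arXiv version,
and typed the statement-level differences it found as tranches 121 – 124; three it scoped at the end of its seat without filing.  ROW B31: the typed field
`Consumers41.HLLZclosure` (tranche 41) quotes v1's Theorems 1.9 (≥_D), 1.12 (≥_C), 1.15 (φ_π ≥_C φ_ψ), 1.16 and « Algorithms 5.2, 5.12, 5.17, 5.22 »; v2 —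
the final arXiv version, under the published title — restates them as Theorem 3.15 (X ∈ {A, C, D}, strict ⪈ in Part (1)), Theorem 1.4 (five orderings, with [HLL22, §11.2]), Theorem 1.3
(= old 1.15 ∧ 1.16, via ψ^max), drops the algorithms (credited to [Ato23] and [HLL22]) and adds Theorem 1.7 = 7.3 (no local Arthur packet of G_n contains
another) with Theorem 7.4; and v2's Theorem 2.2 is « [Mœ11b, Proposition 5.1] » — row C168's typed LOCAL statement (`Consumers54.MoeglinImage` quotes
Proposition 5.1) —, through which Definition 3.8 defines ψ^max(π): a NEW premise C168 next to tranche 41's book ∧ B2 ∧ B5 ∧ B42 ∧ B101.  ROW B44: tranche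
53's field quotes v1's « Théorème 2.3 » (the discrete series of the thirteen symmetric spaces 𝒳 = G/H satisfy the Sakellaridis – Venkatesh prediction);
v2 has no such head: the result is Proposition 3.1 (⇐ « les résultats de [MR20] et [MR19] »), Corollaire 4.2 (the SL(2, ℂ)-restriction of ψ_π is η_X),
§§5–7 (the W_ℝ-part, Proposition 7.3 for case 3 with n odd) and §8 (Propositions 8.1 – 8.18: which members of Π(G, ψ) are discrete series for which X, read
on Arthur's characters ε(π) « déterminés » by [MR20], [MR19]); same premises A8 ∧ B24.  ROW C16: Theorem 5.1 = Appendix B's Theorem B.2 (holomorphy and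
non-vanishing of the normalized local intertwining operators N(ω₀, τ ⊗ σ, s) for Re(s) ≥ 1/2, σ in a generic L-packet of a pure inner form H_m of a
quasi-split unitary or special orthogonal group) is a statement of a typed row (C16: `Consumers8.JZclass` / `JZmain` / `JZmainQS`) that the register had
not typed and that row C35's journal-era text (arXiv v7, Remark 1.1 (iii)) consumes by number; its proof opens « the local L-packet Π̃_φ+(H_m) has a generic
member σ° ([3] and [71]) when H_m = H*_m is quasisplit » and runs inside the L-packets of the pure inner forms that the paper takes from « [3], [71] and
[53] » (§2.2) — for unitary H_m: Mok ∧ KMSW, the generic parameters lying in KMSW's proved scope; Proposition B.1 (irreducibility of generic standard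
modules: Mœglin – Waldspurger [68], Gan – Ichino « [18, Proposition 9.1] » = row B18, where it is Heiermann's theorem [hei], Heiermann [29], Adams –
Barbasch – Vogan [1]), Cogdell – Kim – Piatetski-Shapiro – Shahidi [11], Kim [55], Mœglin – Waldspurger [66], Waldspurger [82], Vogan [80], Tadić [79]:
published and Arthur-free, absorbed.  ROW C36: tranche 69's `Consumers69.ZhuOrthogonalIH` quotes the 2018 thesis text (its introduction theorem for odd n and
« Theorem 246 » (1)–(3) under « Hypothesis 202 ») ⇐ the book ∧ row A3 (Taïbi) ∧ the node `ZhuHyp202`; unit `pub-arthur-down-g52` compared it with arXiv v3 for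
numbering, scope and the status footnote only (D-DN-g52-5) and left the statements unread (G-DN-510 (5)); read here: v3's chapter 9 states Theorem 9.7.5 (the
partial Hasse–Weil zeta function of IH*(Sh_K, 𝕍) for G = SO(V, q) of signature (d − 2, 2) quasi-split at all finite places, both parities — d ≡ 2, 3, 4, 5, 6
mod 8, or d ≡ 0 mod 8 with δ ≠ 1 —, with m_ψ ∈ {1, 2}: the 2018 text's « Theorem 241 » for the traces, already for both parities, of which the typed field
quotes the odd-n introduction version; v3 spells out the meromorphic continuation of ζ^S), Theorem 9.8.5 (1)–(4) (old « Theorem 246 » (1)–(3) plus a NEW part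
(3): the constituents π_i of a contributing ψ are tempered at almost all p — « new instances » of Ramanujan–Petersson in the even symmetric case, Remark 9.8.6 —,
and part (4) now under the conclusion of Lemma 9.8.3 — proved there unconditionally in the odd and even-composite cases, where the 2018 text assumed the
irreducibility « [arthurbook] holds for all the localizations » —), and NEW Corollaries 9.8.8 / 9.8.10 (the decomposition of IH^j_c and of W^j_c(τ) degree by
degree by Galois representations M(ψ, ν, j), odd / even-composite cases; the 2018 text's « Corollary 247 » is a single trace identity for the virtual
Σ_i (−1)^i W̃(π_0)^i), all under Hypothesis 9.1.2 = tranche 69's node (v3: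
« essentially follows from Kottwitz’s … unpublished notes. Recently an alternative proof has been given by Z. Peng [Pen19] », Amer. J. Math. 141 (2019) —
recorded as in D-DN-g52-5, not typed as a supply edge: the text keeps the hypothesis assumed); premises: the book BY NUMBER throughout chapter 9 (Thms 1.3.2,
1.4.1, 1.4.2, 2.2.1, 4.1.2, Lem. 3.3.1, 4.4.1, Props 3.4.1, 4.1.1, §§1.3–1.5, 3.1–3.4), row A3 = [Taï19] (Taïbi, J. Eur. Math. Soc. 21 (2019): Props 3.1.2, 3.2.5,
3.3.1, Thm 4.0.1, §§2, 3.2–3.4), row B1 = [AMR18] (Arancibia – Mœglin – Renard, Ann. Fac. Sci. Toulouse 27 (2018): « part (2) is proved in [AMR18] », Prop.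
9.3.5 — a DIRECT use, new against tranche 69 where [AMR] entered through A3 only), and the node; row A7 = [Xu18, Appendix] only for the even-symmetric,
all-d_i = 1 branch of Lemma 9.8.3, which none of the typed statements needs (9.8.5 (4) takes the lemma's conclusion as hypothesis; 9.8.10 is odd / even
composite) — not a premise; Kottwitz [Kot90], Morel, Kisin – Shin – Zhu, Caraiani [Car12], [BLGGT14], Looijenga, Saper – Stern, Pink, Arthur's stabilisation
[Art01–03], Ngô, Waldspurger: Arthur-free or upstream, absorbed.  THE AUTHORS' WORDING on the monographs' open inputs: B31 v2 — none (G-i; the general-G statements of §§1, 6 keep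
their explicit assumption of a local Arthur packets theory, G-vii, line comments); B44 v2 — none (G-i); C16 — none in Appendix B or §5 (the row's grade is
tranche 8's); C36 v3 — FLAGGED: footnote (3) « The results in [Art13] are contingent on the release of several upcoming papers, including the reference
[A25], which have not appeared as of the time of writing. » (p0013:L42-43, as D-DN-g52-5 recorded) next to « Arthur’s work [Art13] depends on the stabilization
of the twisted trace formula as a hypothesis, and the latter has been established by Moeglin–Waldspurger [MW17].(1) » with « (1)However, see footnote 3 on
p. 3. » (p0249:L27-30).

**Deliberately not here.**  Any content of a node; any claim that a downstream theorem is true or false; B31 v2's §6 for a general quasi-split G (Theorem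
6.9 under Working Hypotheses 6.8; Theorem 6.14, a new proof of row B101's enhanced-Shahidi theorem for Sp_{2n}, split SO_{2n+1} — line comments); B44's
twisted variant by a character χ of H (« Nous ne démontrons rien dans le cas où χ est non trivial », `arxiv-1906.00725v2/` p0002:L34-35); C16's
Theorems 5.3 / 5.7 (tranche 8's `JZmain`) and its §§4–6; C36 v3's chapters 1–8 (the stabilisation of the Frobenius–Hecke traces itself, Theorem 1 =
Corollary 8.17.5, Arthur-free) and a supply edge for `ZhuHyp202` from Peng 2019; the exact-support computations (a `DownstreamSupport` section can follow once the olean store is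
rebuilt); a concordance edge old-field → new-field for B31, B44 or C36 (the later text of each has content the typed earlier statement lacks, so none is asserted;
the side-by-side theorems derive both from the same inputs instead).  No Mathlib, no `axiom`, no `sorry`, no `opaque`.
-/

set_option autoImplicit false

namespace Literature.NumberTheory.Automorphic.Arthur2013

namespace Downstream

/-! ## Hundred-and-twenty-fifth tranche (v1, unit `pub-arthur-down-g54`): THE LATEST arXiv TEXT STATES V — row B31 v2 (`HLLZclosureV2`), row B44 v2
(`MRsymmetricV2`), row C16 Appendix B Theorem B.2 = Theorem 5.1 (`JZnlio` as printed, `JZnlioU` the unitary-group instance), row C36 v3 (`ZhuIHv3`)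

Context (`DOWNSTREAM.md` rows B31 `[g10]` (tranche 41 `Consumers41.HLLZclosure`, `E_HLLZclosure` ⇐ book ∧ B2 ∧ B5 ∧ B42 ∧ B101), B44 `[g13]` (tranche 53
`Consumers53.MRsymmetric`, `E_MRsymmetric` ⇐ A8 ∧ B24), C16 (tranche 8 `Consumers8`, `E_JZclass` / `E_JZmain` / `E_JZmainQS`), C35 (tranche 34
`Consumers34.HaanGGP`; tranche 124 `Consumers124.HaanGGPv7`, in `Downstream35.lean`, not importable here), C168 `[g13]` (tranche 54 `Consumers54.MoeglinImage`,
whose support is tranche 54's `adamsLine_of_node`), C36 `[g18]` (tranche 69 `Consumers69.ZhuOrthogonalIH`, node `ZhuHyp202`, `E_ZhuOrthogonalIH` ⇐ book ∧ A3 ∧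
node; D-DN-g52-5), A3 / B1 (tranche 1 `Consumers.TaibiInner` / `Consumers.AMR`); `DOWNSTREAM5.md` Block B¹³⁵ addendum III `[g54]` (this tranche's census record); GAPS G-DN-510 … 513;
CITED-FACTS5 §DN-g54; DIVERGENCE3 §DN-g53 D-DN-g53-12, §DN-g54).  Texts under `HOME/pub-arthur-down-g53/primaries/`: `arxiv-2209.03816v2/` (B31 v2),
`arxiv-1906.00725v2/` (B44 v2), `arxiv-1508.03205v4/` (C16); under `HOME/pub-arthur-down-g54/primaries/`: `vor-hazu-b44/` (B44 version of record, cover page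
only); under `HOME/pub-arthur-down-g52/primaries/`: `arxiv-1801.09404v3/` (C36 v3).  Loci: B31 v2 p0001:L4-7, p0002:L19-21, L37-38, L44-47, p0003:L20-48, p0004:L25-32, p0005:L5-21, L29-31, p0006:L28-36, p0007:L38-41, p0008:L28,
p0009:L5, L15-17, L25-29, p0010:L36-42, p0011:L48-49, L54-58, p0012:L19-20, L28-29, p0014:L8-25, p0034:L36-38, p0037:L15, L24-26, p0038:L2-5, L27-31,
p0039:L8-10; B44 v2 p0001:L32-34, p0002:L39-50, p0003:L1-14, L26-35, p0004:L8-16, L23-43, p0011:L50, p0013:L38-50, p0014:L3-16, p0019:L15-20,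
p0027:L11-12, p0028:L12, p0029:L38-52, p0030:L38; C16 p0013:L21-27, p0016:L23-29, p0045:L13-14, p0048:L10-26, p0084:L37-46, p0085:L3-24, L36-45,
p0086:L2-12, L22-24, p0087:L8-20, L32-33; C36 v3 p0001:L1-6, p0013:L34-36, L42-43, p0014:L4-41, p0249:L19-30, p0250:L2-12, p0252:L19-28, p0258:L12,
p0263:L49, p0264:L26, p0265:L12, p0267:L22-23, p0268:L9-13, L30-38, p0269:L5-7, p0281:L30-33, p0285:L28-39, p0286:L18-33, p0287:L11-21, L32-34, p0288:L6-12,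
p0289:L15-19, L38-41, p0290:L37-44, p0291:L2-8, p0294:L26-32, p0295:L2, L31-33, L50-53, p0296:L25-26. -/

/-- Rows B31 (arXiv v2), B44 (arXiv v2), C16 (Appendix B, twice) and C36 (arXiv v3) of the census, as an arbitrary assignment of truth values: what the register records is
which typed input the TEXT invokes (the `E_…` hypotheses below), never the truth of a field. [cite: Arthur2013, downstream register of the cell, hundred-and-twenty-fifth tranche (structure only)] -/
structure Consumers125 where
  /-- B31 in arXiv v2 (2024-04-05, the final arXiv version, under the title of the published article J. reine angew. Math. 823 (2025) 1–60, doi:10.1515/crelle-2025-0012, whose version of record was not compared; A. Hazeltine – B. Liu – C.-H. Lo – Q. Zhang, *The closure ordering conj… on local Arthur packets of classical groups* (title word abbreviated; title line in the `--` comment); `arxiv-2209.03816v2/`; F non-archimedean of characteristic zero, G_n = Sp_{2n}(F) or split SO_{2n+1}(F): p0005:L29-31 "LetFbe a non-Archimedean local ﬁeld of characteristic zero and l etq=qFdenote the cardinality of its residue ﬁeld. Let G ndenote one of the groups Sp2nor SO2n+1deﬁned and split over Fand letGn= Gn(F). Let| · |denote the normalized absolute value of For the Weil group WF. We also"), THE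 THEOREMS AS STATED THERE.  THEOREM 1.3 p0003:L23-27 "Theorem 1.3 (Theorem 3.15and§5).LetGnbeSp2nor splitSO2n+1. Ifπ∈ΠA(Gn), then we have (1)for anyψ∈Ψ(π) :={ψ|π∈Πψ}, φψmax(π)≥Cφψ; (2) φπ≥Cφψmax(π)." (its closing sentence names a conj.: `--` comment; ψ^max(π): p0003:L29 "parameter of π, introduced in [HLL22](see Deﬁnition 3.8).").  THEOREM 1.4 [≥_O, ≥_D, ≥_A, ≥_N, ≥_C the five orderings of p0003:L32-36] p0003:L38-41 "Theorem 1.4 (Theorems 3.14,3.15, [HLL22,§11.2]).For anyπ∈ΠA(Gn), under any of these ﬁve orderings ≥XonΨ(π),ψmax(π)andψmin(π)(see Deﬁnition 3.8) are the unique elements in Ψ(π)such that for any ψ∈Ψ(π)the following inequality holds (1.4) ψmax(π)≥Xψ≥Xψmin(π)."  THEOREM 1.7 p0005:L11 "Theorem 1.7 (Theorem 7.3).Given anyψ1,ψ2∈Ψ+(Gn). IfΠψ1⊇Πψ2, thenψ1=ψ2." = THEOREM 7.3 p0038:L28 "Theorem 7.3. Given anyψ1,ψ2∈Ψ+(Gn).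 IfΠψ1⊇Πψ2, thenψ1=ψ2." with THEOREM 7.4 p0038:L31 "Theorem 7.4. Given anyψ1,ψ2∈Ψ+(Gn). IfΠφψ2∩Πψ1̸=∅andΠφˆψ2∩Πˆψ1̸=∅, thenψ1=ψ2."  THEOREM 3.15 p0014:L17-23 "Theorem 3.15. LetX∈ {A,C,D}. (1)For anyψ∈Ψ+(Gn)and any raising operator Tapplicable on ψ, we have T(ψ)⪈Xψ. In particular, if ψ≥Oψ′, thenψ≥Xψ′. (2)Letπ∈ΠA(Gn). The parameters ψmax(π)andψmin(π)are the unique elements in Ψ(π)such that for any ψ∈Ψ(π), the following inequality holds ψmax(π)≥Xψ≥Xψmin(π). (3.3)" (with p0014:L24-25 "Remark that Part (2) follows from Part (1) and Theorem 3.14. The above theorem for Aordering is proved in [ HLL22,§11.1]. We shall prove the theorem for Cordering in §4.3and forDordering in §7.").  DEFINITION 3.8 p0012:L19-20 "Deﬁnition 3.8. Letπ∈ΠA(Gn). Writeπ=τψ1⋊π0as in Theorem 2.2, whereπ0is of good parity. Take any Esuch thatπ(E) =π0. Then we deﬁne" […].  Against tranche 41's `Consumers41.HLLZclosure` (corpus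 TeX of v1): its Theorems 1.9 (≥_D) and 1.12 (≥_C) are Theorem 3.15 here (X ∈ {A, C, D}; strict ⪈ in Part (1)) with Theorem 1.4; its Theorems 1.15 and 1.16 are Theorem 1.3; its « Algorithms 5.2, 5.12, 5.17, 5.22 (§5) » are absent (p0002:L44-47 "accounts for the diﬃculties of many problems related to loca l Arthur packets. For symplectic and split odd special orthogonal groups, Atobe ([ Ato23]), the ﬁrst three-named authors ([ HLL22]), independently gavediﬀerentalgorithmstodeterminewhetheragivenrepres entation isofArthurtype, andtodetermine all local Arthur packets containing a given representation of Arthur type."); Theorem 1.7 is new.  NOT in the field: §6 for a general quasi-split G (Theorem 6.9 under Working Hypotheses 6.8; Theorem 6.14 = a new proof of row B101's theorem for Sp_{2n}(F), split SO_{2n+1}(F); explicit hypothesis, G-vii; `--` comments). [cite: HazeltineLiuLoZhang2025Closure, Thm 1.3 (p0003:L23-27), Thm 1.4 (p0003:L38-41), Thm 1.7 (p0005:L11) = Thm 7.3 (p0038:L28), Thm 7.4 (p0038:L31), Thm 3.15 (p0014:L17-23), Def. 3.8 (p0012:L19-24) (arXiv v2)] -/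
  HLLZclosureV2 : Prop
  /-- B44 in arXiv v2 (2023-02-24, « 38 pages »; C. Mœglin – D. Renard, *Séries discrètes des espaces symétriques et paquets d'Arthur*; `arxiv-1906.00725v2/`; version of record Rad Hrvat. Akad. Znan. Umjet. Mat. Znan. 28 (2024) 353–403 = Rad HAZU knj. 558, doi:10.21857/moxpjhzvwm (bib MoeglinRenard2024Symetriques NEW; the register's MoeglinRenard2020Symetriques is the same paper keyed before collation), image-only scan, body NOT compared; G a real classical group — p0001:L32-34 "reviendrons ci-dessous. De plus, nous supposons que Gest un groupe général linéaire, un groupe unitaire, un groupe symplectique ou bien un groupe spécial o rthogonal (nous dirons simplement queGest un groupe classique)." —, X = G/H one of the thirteen symmetric spaces of the list p0002:L45 – p0003:L7, p0002:L43-44 "et [KS17 ], Table 3, nous établissons alors la liste des espaces symét riques X=G/H avecG classique ayant un spectre discret. Cette liste, qui compor te treize cas, est la suivante :"), THE STATEMENTS AS PRINTED THERE (v2 prints no « Théorème 2.3 », the head tranche 53's `Consumers53.MRsymmetric` quotes from v1).  THE CLAIM (introduction) p0003:L26-29 "Cette réalisation des séries discrètes de Xen termes d’induction cohomologique permet, en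 utilisant nos travaux antérieurs ( cf.[MR20 ], [MR19 ]) sur les paquets d’Arthur des groupes classiques réels, de fournir pour chaque série discrète πdeXun paramètre d’Arthur explicite ψπtel queπsoit dans le paquet d’Arthur correspondant Π(G,ψπ). On rappelle dans la section"  PROPOSITION 3.1 p0013:L46-50 "Proposition 3.1 . —SoitLle sous-groupe de Levi dual de LdansG∨. Soitπune série discrète deX. Alorsπest contenue dans un paquet d’Arthur de paramètre ψπ:WR×SL(2,C)−→LG tel que la restriction de ψπàSL(2,C)soit à conjugaison près le morphisme de Jacobson-Morozov associé à l’orbite unipotente régulière de L."  COROLLAIRE 4.2 p0019:L17-20 "Corollaire 4.2 . —Soitπune série discrète de X. Alorsπest contenue dans un paquet d’Ar- thur de paramètre ψπtels que la restriction de ψàSL(2,C)soit à conjugaison près le morphisme de Jacobson-Morozov ηXassocié à l’orbite unipotente régulière de L∨ X." (its gloss, p0019:L21-22, names a conj.: `--` comment; case 1 explicitly: PROPOSITION 3.2 / COROLLAIRE 3.3, p0014:L11-14 "Corollaire 3.3 . —Le paramètre d’Arthur d’une série discrète πdeXréalisée par induction parabolique comme dans la proposition est ψπ=p⨁ i=1(δi⊠R[1])⊕(TrivWR⊠R[n−2p]),"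 […]).  PROPOSITION 7.3 (case 3, n odd) p0027:L11-12 "Proposition 7.3 . —Soitψπle paramètre d’Arthur d’une série discrète de X(on est dans le cas 3,nimpair). La restriction de ψàWRse factorise, à conjugaison près, par le produit semi-" […] (its conclusion, L13-14, names a conj.: `--` comment).  §8, PROPOSITIONS 8.1 – 8.18 (which members of Π(G, ψ) are discrete series for which X): the frame p0004:L25-28 "Dans la section 8 nous considérons les paramètres d’Arthur ψdéterminés dans la section 3.2, mais ici nous ne partons pas d’une série discrète π, ni même de la forme réelle G. Au contraire on cherche à savoir quelles sont les représentations πdu paquet Π(ψ)qui sont des séries discrètes pourX, pour un certain X. L’idée est évidemment que tout paquet associé à un morphism e" […] e.g. PROPOSITION 8.2 p0029:L45-46 "Proposition 8.2 . —Soitψcomme ci-dessus et π∈Π(U(p,q),ψ). Alorsπest dans le spectre discret de Xr,ssi et seulement si ǫ(π) = (ǫ1(π),...,ǫ2(r+s)(π),ǫ0(π))vériﬁe" […]. [cite: MoeglinRenard2020Symetriques, Prop. 3.1 (p0013:L46-50), Cor. 4.2 (p0019:L17-20), Prop. 3.2 / Cor. 3.3 (p0014:L3-16), Prop. 7.3 (p0027:L11-14),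 Props 8.1–8.18 (pp. 28–32), introduction (p0003:L26-29, p0004:L25-43) (arXiv v2)] [cite: MoeglinRenard2024Symetriques, version of record (cover page `vor-hazu-b44/` p0001:L13-21; body not compared)] -/
  MRsymmetricV2 : Prop
  /-- C16, THEOREM 5.1 = APPENDIX B THEOREM B.2 AS PRINTED (D. Jiang – L. Zhang, *Arthur parameters and cuspidal automorphic modules of classical groups*, Ann. of Math. (2) 191 (2020) 739–827; `arxiv-1508.03205v4/` = arXiv v4, 2019-11-19; F a number field for Theorem 5.1, a local field of characteristic 0 in Appendix B; H*_m a quasi-split unitary or special orthogonal group of the paper's §2, H_m a pure inner form: p0084:L38-44 "Throughout this appendix, let Fbe a local ﬁeld of characteristic 0. Recall that H∗ mis a quasi-split classical group deﬁned over Fand Hmis a pure inner F-form ofH∗ m. Letφbe a localL-parameter of H∗ m(F) and˜Πφ(Hm) the associated L-packet. Assume that φisgeneric,").  THEOREM 5.1 p0048:L11-22 "Theorem 5.1. Letτ=τ1⊞···⊞τrbe the irreducible isobaric auto- morphic representation of GE/F(a)(A)as in(4.1), andσ∈Acusp(Hm) of a generic global Arthur parameter φσ. Then, for each local place ν ofF,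 the normalized local intertwining operator N(ω0,τ⊗σ,s)νfrom the induced space IndHa+m(Fν) Pˆa(Fν)|·|sτν⊗σνtoIndHa+m(Fν) Pˆa(Fν)|·|−sτ∗ ν⊗σν is holomorphic and nonzero for Re(s)≥1 2, whereτ∗ ν=ι(τν)∨is the contragredient of ι(τ)." (p0048:L23-26 "We remark that when HmisF-quasisplit, much stronger result than what stated in Theorem 5.1 can be proved when σis also assumed to be generic (see [11], for instance and also see [64]). We will prove Theorem 5.1 in Appendix B.").  THEOREM B.2 p0085:L38-45 "Theorem B.2. Letφ+be a localν-component of an Hm-relevant, generic global Arthur parameter of H∗ m. Ifτis an irreducible admissi- ble unitary generic self-dual representation of GE/F(a)(F)andσis an irreducible representation in the generic local L-packet˜Πφ+(Hm), then the normalized local intertwining operator N(ω0,τ⊗σ,s)is holomor- phic and nonzero for Re(s)≥1 2." (p0085:L37 "5.1. It is clear that Theorem 5.1 follows from the following theorem.").  With PROPOSITION B.1 p0085:L13-17 "Proposition B.1. Ifφis a generic L-parameter of H∗ mas given in (B.1), then all representations in ˜Πφ(Hm)can be written as irreducible standardmodules, thatis, the inducedrepresentationsdis playedin (B.2) are irreducible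 for all pure inner forms Hmandσ0∈˜Πφ(Hn0)."  Not among tranche 8's fields `Consumers8.JZclass` / `JZmain` / `JZmainQS` (Theorem 2.1; Theorems 5.3, 5.7; their quasi-split case). [cite: JiangZhang2020, Thm 5.1 (p0048:L11-22) = Thm B.2 (p0085:L38-45), Prop. B.1 (p0085:L13-17) (arXiv v4 pagination)] -/
  JZnlio : Prop
  /-- C16, THE UNITARY-GROUP INSTANCE of `JZnlio`: Theorem B.2 = Theorem 5.1 for H*_m a quasi-split UNITARY group U_{E/F} and H_m any of its pure inner forms (E/F quadratic) — the instance row C35 invokes in arXiv v7 (Math. Ann. 389 (2024); J. Haan; text `arxiv-2002.07773v7/` under `HOME/pub-arthur-down-g53/primaries/`, Remark 1.1 (iii) p0005:L9-11 "(iii) For each place vofFand1≤i≤t, thelocal normalizedintertwiningoperator Nv(z) forσi,v×π1,v is holomorphic and nonzero for all zwith Re(z)≥1 2." […] p0005:L26-27 "where the local L-factors and ǫ-factors are deﬁned through the localization of the global A-parameter of π1as described in [39] and [44]. Then the property (iii) mentio ned above follows from [35, Theorem B.2]." — [35] = this paper, [39] = KMSW, [44] = Mok; Remark 1.1 is quoted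 at length in tranche 124's `E_HaanGGPv7`).  Statement: as in `JZnlio` with H_m unitary. [cite: JiangZhang2020, Thm B.2 = Thm 5.1 restricted to unitary H_m (p0085:L38-45; groups p0013:L21-24); Haan2023, Remark 1.1 (iii) (p0005:L9-11, L26-27, arXiv v7), the consumer] -/
  JZnlioU : Prop
  /-- C36 in arXiv v3 (2023-12-11, « Final revision. To appear in Astérisque », 316 pp.; Crossref doi:10.24033/ast.1225, Astérisque (2024), not compared; Yihang Zhu, *The stabilization of the Frobenius–Hecke traces on the intersection cohomology of orthogonal Shimura varieties*; `arxiv-1801.09404v3/` under `HOME/pub-arthur-down-g52/primaries/`; the setting of chapter 9: p0269:L5-6 "9.4.4. — In the rest of the paper we fix d≥5,δ,(V,q),G∗as in §9.4.1, and fix (V,q),Gas in part (2) of Lemma 9.4.2. We shall apply the preceding parts of this" […] with Lemma 9.4.2 (2) p0268:L30-34 "(2)Assume either of the following two conditions: –d≡2,3,4,5,6 mod 8 . –d≡0 mod 8 andδ̸= 1∈Q×/Q×,2. Then there is a quadratic space (V,q)overQ, of dimension d, discriminant δ, and signature (d−2,2)at∞, such that G:= SO(V,q)is quasi-slit at all finite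 places." — G = SO(V, q) of signature (d − 2, 2) quasi-split at all finite places, d ≥ 5, both parities; Sh_K its Shimura varieties, IH^* = IH^*(Sh_K, 𝕍) the intersection cohomology of the Baily–Borel compactification with coefficients 𝕍 as in §9.5.1), THE STATEMENTS OF CHAPTER 9 AS PRINTED THERE, all under HYPOTHESIS 9.1.2 = tranche 69's node `Consumers69.ZhuHyp202` (p0250:L6-9 "Hypothesis 9.1.2 . — LetHbe a quasi-split reductive group over Q. For test func- tionsfonH(A)which are stable cuspidal at infinity, we have STH(f) =SH(f). HereSTH(f)denotes Kottwitz’s simplified geometric side of the stable trace formula (see §8.3), andSH(f)denotes Arthur’s stable trace formula [Art02, Art01, Art03 ].").  The introduction's THEOREM 2 p0014:L11-14 "Theorem 2 (Theorem 9.7.5, Remark 9.7.6). — Assume that nis odd, and that G= SO(V,q)is quasi-split at all finite places. For any finite set Sof prime numbers, letζS(IH∗,s)be theS-partial Hasse–Weil zeta function associated to IH∗. WhenS is sufficiently large, we have" [display] p0014:L20-28 "Hereψruns through a certain set of Arthur’s substitutes of global Arthur parameters, π∞runs through the away-from- ∞global packet of ψ, andνruns through characters of the centralizer group of ψ(which is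 finite abelian). The three-fold summation is over a finite range. The numbers m(π∞,ψ,ν )∈{0,1}andν(sψ)∈{± 1}are defined in terms of constructions in [Art13 ]and[Ta¨ı19]. The term LS(M(ψ,ν),s)is a finite product ofS-partial standard automorphic L-functions for general linear groups (with some shifting in the variable s), and hence has meromorphic continuation to C. In particular, the above formula implies that ζS(IH∗,s)has meromorphic continuation toC."  THEOREM 9.7.5 p0285:L28-29 "Theorem 9.7.5 . — Assume Hypothesis 9.1.2. Let Sbe the set Σbad(K,1K)as in (9.5.1.1), applied to f∞= 1K. For all primes p /∈Swe have" [display: log ζ_p(IH^*(Sh_K, 𝕍), s) = Σ_{ψ ∈ Ψ̃(G*)_𝕍} Σ_{π^∞ ∈ Π̃^∞_ψ(G)} dim(π̇^∞)^K · Σ_{ν ∈ S^D_ψ} m(π^∞, ψ, ν) (−1)^n ν(s_ψ) log L_p(M_p(ψ, ν), s); m_ψ ∈ {1, 2}, « In the odd case it is always 1 »] whence p0286:L18-20 "forsin some right half plane. This expresses ζS(IH∗(ShK,V)),s)as a finite product of integral powers of LS(M(ψ,ν),s)for various ψandν, and gives a meromorphic continuation of ζS(IH∗(ShK,V)),s)to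 the whole C."  THEOREM 9.8.5 p0290:L37-39 "Theorem 9.8.5 . — Assume Hypothesis 9.1.2. Let c∈˜CA(G∗). The following state- ments hold. (1)Ifcis not in the image of ˜Ψ(G∗)Vunder the map (9.8.4.1), then" [IH^j_c = 0 for all j] p0290:L43-44 "(2)Assume that c=c(ψ)forψ∈˜Ψ(G∗)V. The for almost all primes pand all integersawe have" [(9.8.5.1): Σ_j (−1)^j Tr(Frob_p^a | IH^j_c) = the corresponding sum] p0291:L2-8 "where the terms on the right hand side are defined in the same way as in Theorem 9.7.5, withMp(ψ,ν)defined in §9.7.3. (3)Keep the assumption in (2), and assume that IHj c̸= 0 for somej. Write ψ=⊞i∈Iπi[di]. Then for each i∈Iand for almost all primes p,πi,pis tempered.(15) (4)Keep the assumption in (2), and assume that the conclusion of Lemma 9.8.3 holds forψ. Thus each π∞∈˜Π∞" […] [then W^j_c(τ₀) = 0 for τ₀ outside the ϑ^∞-orbits [π^∞], and (9.8.5.2)].  LEMMA 9.8.3 p0289:L15-18 "Lemma 9.8.3 . — Letψ=⊞iπi[di]∈˜Ψ(G∗)V. In the odd case and the even com- posite case, the G(Qv)-representations in ˜Πψv(Gv)are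 irreducible for all finite places v. If we are in the even symmetric case and all diare equal to 1, then the same conclusion also holds."  COROLLARY 9.8.8 p0295:L2 "Corollary 9.8.8 . — Letc=c(ψ). For each integer j, we have" [(9.8.8.1), degree by degree] and COROLLARY 9.8.10 p0295:L50-53 "Corollary 9.8.10 . — Letc=c(ψ), and letπ∞ 0∈˜Π∞ ψ(G). Assume that we are in the odd case or the even composite case. Up to semi-simplification, the ΓQ-representations" [IH^j_c and ⊕_{τ ∈ [π^∞_0]} dim(τ^K) · W^j_c(τ) ≅ the stated virtual sums of the ℓ-adic Γ_ℚ-representations M(ψ, ν, j)].  Against tranche 69's `Consumers69.ZhuOrthogonalIH` (corpus TeX of the 2018 thesis text): its introduction theorem (n odd) is Theorem 2 here, the odd case of Theorem 9.7.5 (the 2018 text's « Theorem 241 » already states the trace formula for both parities; v3 adds the meromorphic-continuation sentence); its « Theorem 246 » (1)–(3) is Theorem 9.8.5 (1), (2), (4), part (4) assuming the conclusion of Lemma 9.8.3 — PROVED in v3 for the odd and even-composite cases — where Theorem 246 (3) assumed « the localizations ψ_v … satisfy [arthurbook] … the representations in Π̃_{ψ_v}(G*_v) are all irreducible »; Theorem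 9.8.5 (3) (temperedness; Remark 9.8.6, `--` comment), Lemma 9.8.3 as a proved statement and Corollaries 9.8.8 / 9.8.10 (the 2018 « Corollary 247 » being one trace identity for the virtual Σ_i (−1)^i W̃(π_0)^i) are new.  NOT in the field: chapters 1–8 (Theorem 1 = Corollary 8.17.5, the stabilisation itself, Arthur-free); Remark 9.8.11. [cite: Zhu2018FrobeniusHecke, Thm 2 (p0014:L11-28), Thm 9.7.5 (p0285:L28-39, p0286:L18-20), Thm 9.8.5 (p0290:L37 – p0291:L27), Lemma 9.8.3 (p0289:L15-18), Cor. 9.8.8 (p0295:L2-12), Cor. 9.8.10 (p0295:L50 – p0296:L24), Hyp. 9.1.2 (p0250:L6-9) (arXiv v3)] -/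
  ZhuIHv3 : Prop

variable (ν : Nodes) (μ : Mok2015.Nodes) (κ : KMSW2014.Nodes) (c : Consumers) (c₂ : Consumers2) (c₅ : Consumers5) (c₈ : Consumers8) (c₂₆ : Consumers26)
  (c₅₃ : Consumers53) (c₅₄ : Consumers54) (c₆₉ : Consumers69) (c₁₂₅ : Consumers125)

-- Verbatim lines kept out of the docstrings by the register's lint (titles, sentences naming a conj., bibliography entries).
-- B31 `arxiv-2209.03816v2/`: title p0001:L1-2 "arXiv:2209.03816v2  [math.RT]  5 Apr 2024THE CLOSURE ORDERING CONJECTURE ON LOCAL ARTHUR PACKETS OF CLASSICAL GROUPS"; abstract p0001:L4-7 "Abstract. In this paper, we prove the closure ordering conjecture on th e localL-parameters of repre- sentations in local Arthur packets of G n= Sp2n,SO2n+1over a non-Archimedean local ﬁeld of charac- teristic zero. Precisely, given any representation πin a local Arthur packet Π ψ, the closure of the local L-parameter of πin the Vogan variety must contain the local L-parameter corresponding to ψ. This";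
--   p0002:L22-23 "ψ∈Ψ(Gn) ([Art13, Theorem 1.5.1]) and conjectured that Π ψalso consists of unitary representations whenψ∈Ψ+(Gn) ([Art13, Conjecture 8.3.1]). In a series of papers ([ Mœ06a,Mœ06b,Mœ09a,Mœ10,"; p0003:L20-22 "local Arthur packet Π ψ. In this paper, we prove Conjecture 1.2for symplectic and split odd special orthogonal groups, applying the intersection theory of loc al Arthur packets developed in [ HLL22]. This provides evidence for the Vogan conjecture in these cases."; Theorem 1.3's last sentence p0003:L28 "Hence, Conjecture 1.2is true for Gn= Sp2nor splitSO2n+1. Here,ψmax(π)is “the” local Arthur";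
--   p0003:L47-48 "We summarize that the key ingredients in the proof of Conject ure1.2above are the reduction to ψmax(π) and the operators introduced in [ HLL22] on the intersection problem of local Arthur packets."; the general-G statements p0004:L6-8 "Conjecture 1.5. LetGbe a connected reductive group deﬁned over a non-Archimedea n local ﬁeld. Assume that there is a local Arthur packets theory for G= G(F)as conjectured in [Art89, Conjecture 6.1]. Letπ∈ΠA(G). Then, for any ψ1,ψ2∈Ψ(π), we haveλφψ1=λφψ2.Furthermore, there are unique" / p0004:L19-21 "Conjecture 1.6 ([LS22, Conjecture 1.5], Enhanced Shahidi Conjecture) .For any quasi-split reductive groupG, suppose that there is a theory of local Arthur packets for G= G(F)as conjectured in [Art89, Conjecture 6.1] . Then, a local Arthur packet is generic if and only if it has a ge neric member."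
--   / p0004:L22-24 "In[LS22], thesecond-named authorandShahidiproved Conjecture 1.6forquasi-split classical groups, withcertain assumption. In[ HLL22], theﬁrstthree-namedauthorsproved Conjecture 1.6forsymplectic and split odd special orthogonal groups, without any assump tion." / p0004:L25-32 "For any quasi-split connected reductive group G, suppose th at there is a theory of local Arthur packets for G= G(F) as conjectured in [ Art89, Conjecture 6.1], we show that Conjecture 1.2, along with Working Hypotheses 6.8, implies that a local Arthur packet of Gis tempered if it has a generic member, which is an essential part of the enhanced Shahidi co njecture (see Theorem 6.9). Then, as an application of Theorem 1.3, we verify these assumptions for symplectic and split odd sp ecial orthogonal groups (see Theorem 7.1and Lemma 6.13), hence giving a new proof of the enhanced Shahidi conjectur e 1.6in these cases (see Theorem 6.14). The merit of this new proof is that it provides a framework o f proving the enhanced Shahidi conjecture for general quasi- split connected reductive groups."; p0015:L18-21 "which can be viewed as a subset of Φ( G)λ. Mœglin proved that all representations in a local Arthur packet Π ψshare the same extended cuspidal support (see [ Mœ09b, Proposition 4.1]) assuming there is a theory of local Arthur packets as in [ Art89, Conjecture 6.1]. As a consequence, for any π∈Πψ, we haveλφπ=λφψ, and for a ﬁxed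 π∈ΠA(Gn), we have an inclusion Ψ( π)⊆Ψ(G)λφπ. Then we may";
--   Theorem 6.14 p0037:L21 "Theorem 6.14. The enhanced Shahidi conjecture 6.1holds for Sp2n(F)and split SO2n+1(F)." with p0037:L24-26 "follows from Theorem 6.9directly. Notice that in this case, Conjecture 1.2is Theorem 1.3, Working Hypotheses 6.8(1) is veriﬁed in [ Xu17,§A] (see Theorem 7.1) and Working Hypotheses 6.8(2) is Lemma 6.13. □"; p0034:L36-38 "It is worth to notice that without assuming generalized Rama nujan Conjecture, Ψ( G) is only a subset of Ψ+(G), the set of all local Arthur parameters (see [ Art13,§1.3] and ( 1.1) forGn). Thus, Conjecture 6.1, which is stated for Ψ( G), does not directly imply Conjecture 1.6, which is stated for Ψ+(G).";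
--   bibliography p0039:L20-21 "[Art13] J. Arthur, The endoscopic classiﬁcation of representations: Orthogo nal and Symplectic groups. Colloquium Pub- lication Vol. 61, 2013, American Mathematical Society. 2,5,6,34,37,39" / p0039:L24 "[Ato22] H. Atobe, Construction of local A-packets. J. Reine Angew. Math. 790pp. 1-51 (2022). 2,7,8,9,10" / p0039:L25-26 "[Ato23] H. Atobe, The set of local A-packets containing a giv en representation. J. Reine Angew. Math. 804pp. 263-286 (2023).2,9,11" / p0039:L27 "[AM23] H. Atobe and A. M´ ınguez, The explicit Zelevinsky-Au bert duality. Compos. Math. 159, 380-418 (2023). 2,8,9"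
--   / p0040:L6-7 "[HLL22] A. Hazeltine, B. Liu, and C. Lo, On the intersection o f local Arthur packets for classical groups. (2022), arXiv.2201.10539. 2,3,4,5,8,9,10,11,12,13,14,15,23,29,30,32,33,34,35,37" / p0040:L52-53 "[Mœ11b] C. Mœglin, Image des op´ erateurs d’entrelacements normalis´ es et pˆ oles des s´ eries d’Eisenstein. Adv. Math. 228 (2011), 1068-1134. 7" / p0041:L13-14 "[Xu17] B. Xu, On Mœglin’s parametrization of Arthur packets for p-adic quasisplit Sp(N) and SO(N). Canad. J. Math. 69, (2017), 890-960. 37,38".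
-- B44 `arxiv-1906.00725v2/`: title p0001:L1-4 "arXiv:1906.00725v2  [math.RT]  24 Feb 2023SÉRIES DISCRÈTES DES ESPACES SYMÉTRIQUES ET PAQUETS D’ARTHUR par Colette Moeglin & David Renard"; résumé p0001:L5-9 "Résumé . —On vériﬁe certaines conjectures de Sakellaridis et Venkate sh donnant une description du spectre discret d’une variété sphérique X=G/H dans le formalisme d’Arthur-Langlands lorsqueGest un groupe classique réel et Xest un espace symétrique. On détermine ensuite explicitement les membres des paquets d’Arthur concernés c ontribuant au spectre discret, ce qui fait apparaître des résultats de multiplicité un."; abstract p0001:L10-14 "Abstract. We check Sakellaridis-Venkatesh conjectures giving a desc ription of the discrete spec- trum of a spherical variety X=G/H in the Langlands-Arthur formalism when Gis a classical real group and Xis a symmetric space. Then, we compute explicitly the repres entations in the relevant Arthur paquets which appear in the discrete spectr um, and we establish some multiplicity one results.";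
--   p0001:L16-17 "Le but de cet article est de vériﬁer certaines conjectures de Sakellaridis et Venkatesh énoncées dans [SV17 ]. Ces conjectures proposent une description du spectre dis cret d’une variété sphé-"; p0003:L46-49 "construction coïncide avec celle prévue par Sakellaridis e t Venkatesh et explicitée dans [ KS17 ], c’est-à-dire que la restriction à SL(2,C)du morphisme conjectural ϕXest bienηX. Ainsi, pour ce qui est de la restriction à SL(2,C)des morphismes ψπetϕX, la conjecture est établie. Les détails sont donnés dans la section 4."; Corollaire 4.2's gloss p0019:L21-22 "Ce corollaire constitue une étape importante dans la vériﬁc ation de la conjecture, puisqu’il dit que la restriction de ψπàSL(2,C)est bien obtenue via le morphisme (4.1)."; Proposition 7.3's conclusion p0027:L13-14 "directSp(2k,C)⋊WR, et donc en particulier satisfait la conjecture de Sakellar idis et Venkatesh avecLGX=Sp(2k,C)⋊WR.";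
--   p0004:L23-24 "La section 5 donne des constructions de L-morphismes utilisés pour construire certains des morphismes ¯ϕX. La ﬁn de la vériﬁcation des conjectures fait l’objet de la se ction 7."; bibliography p0037:L41-44 "[MR19] C. Mœglin &D. Renard – « Sur les paquets d’Arthur des groupes unitaires et quelque s conséquences pour les groupes classiques », Paciﬁc J. Math. 299(2019), no. 1, p. 53–88. [MR20] , « Sur les paquets d’Arthur des groupes classiques réels », J. Eur. Math. Soc. (JEMS) 22(2020), no. 6, p. 1827–1892.".
-- B44 version of record, repository cover page `vor-hazu-b44/` (under `HOME/pub-arthur-down-g54/primaries/`) p0001:L1-3 "Séries discrètes des espaces symétriques et paquets d’Arthur / Colette Moeglin, David Renard" / p0001:L9-16 "https://dizbi.hazu.hr/a/?pr=i&id=2632233 Bibliografska razina a – analitička jedinica (sastavnica) Autor Moeglin, Colette Ostali autori Renard, David Stranice 353 – 403 Sažetak Diskretne serije simetričnih prostora i Arthurovi paketi Jezik teksta fre – francuski DOI DOI: 10.21857/moxpjhzvwm".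
-- C36 `arxiv-1801.09404v3/` (under `HOME/pub-arthur-down-g52/primaries/`): title page p0001:L1-6 "Yihang Zhu THE STABILIZATION OF THE FROBENIUS–HECKE TRACES ON THE INTERSECTION COHOMOLOGY OF ORTHOGONAL SHIMURA VARIETIESarXiv:1801.09404v3  [math.NT]  11 Dec 2023"; p0013:L34-36 "Currently some of these premises related to Arthur’s conjectures have been estab- lished in special cases. Most notably, Arthur [ Art13 ] has established the multiplicity conjectures for quasi-split classical groups.(3)In fact, our interest in delving into spe-" with footnote (3) p0013:L42-43 "(3)The results in [ Art13 ] are contingent on the release of several upcoming papers, including the reference [A25], which have not appeared as of the time of writing.";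
--   p0014:L29-34 "In the proof of Theorem 2, one crucial ingredient is a relatively simple formula for STH(fH) when the test function fHisstable cuspidal at the real place; see Hypothesis 9.1.2. This formula follows from Kottwitz’s stabilization of the L2Lefschetz number formula in his unpublished notes, and is also used in Morel’s work [ Mor10b, Mor11 ]. A self-contained proof of this formula for STH(fH), from a different point of view, is given in a recent paper by Z. Peng [ Pen19 ]."; p0249:L15-18 "(1) Arthur’s conjectural parametrization and multiplicity formula for automorphic representations. (2) The closely related conjectural spectral expansion of the stable trace formula in terms of Arthur parameters."; p0287:L17-21 "(2) In both the odd and even cases, for a general ψ∈˜Ψ2(G∗) it is not known (although expected, as would follow from the Ramanujan–Petersson conjecture for general linear groups) that the localization ψvis bounded on WD vfor all finite places v. As a result of this drawback, the G(Qv)-representations in the local packet ˜Πψv(Gv) are not known to be irreducible." / p0287:L28-34 "the localization of a global parameter), Arthur has conjectured that the G∗(Qv)- representations in the local packet ˜Πψv(G∗ v) are irreducible. See [ Art13 ,§§1.3–1.5, Conjecture 8.3.1] for more details. This conjecture would imply that the G(Qv)- representations in ˜Πψv(Gv) are irreducible. In the even case, if ψis “trivial on SL 2” in the sense that ψ=⊞iπi[di]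 with alldiequal to 1, then this conjecture has been proved(13)by B. Xu [ Xu18 , Appendix].";
--   Remark 9.8.6 p0294:L26-32 "Remark 9.8.6 . — Part (3) of Theorem 9.8.5 proves the Ramanujan–Petersson con- jecture forπifor almost all primes. As we have discussed in §9.8.1 and §9.8.2, this is known in the odd case and in the even composite case (where the conjecture is known for all primes). In the even symmetric case, however, the infinitesimal character of πi,∞can be non-regular, and thus πi⊗|det|αis not cohomological for any α∈C. For suchπiour result proves new instances of the conjecture. We postpone a more systematic treatment to future work."; Remark 9.8.11 p0296:L27-31 "Remark 9.8.11 . — In the even symmetric case, for ψ=⊞i∈Iπi[di]∈˜Ψ(G∗)V, the infinitesimal character of πi,∞can be non-regular. Thus the conjectural ℓ-adic Γ Q- representation associated to (an L-algebraic twist of) πihas not been constructed. To this end our Corollary 9.8.8 can be utilized for the construction of such a Galois representation. We will investigate this on another occasion.";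
--   bibliography p0308:L2-4 "[Art13] ,The endoscopic classification of representations , American Mathematical Society Colloquium Publications, vol. 61, American Math- ematical Society, Providence, RI, 2013, Orthogonal and symplectic" / p0315:L26-28 "[Ta¨ ı19] , “Arthur’s multiplicity formula for certain inner forms of spe- cial orthogonal and symplectic groups”, J. Eur. Math. Soc. (JEMS) 21 (2019), no. 3, p. 839–871." / p0307:L8-10 "[AMR18] N. Arancibia, C. Mœglin &D. Renard – “Paquets d’Arthur des groupes classiques et unitaires”, Ann. Fac. Sci. Toulouse Math. (6) 27 (2018), no. 5, p. 1023–1105." / p0313:L30-31 "[MW17] C. Mœglin &J.-L. Waldspurger –Stabilisation de la formule des traces tordue , Progress in Mathematics 316 and 317, Birkhauser, 2017." / p0313:L34-35 "[Pen19] Z. Peng – “Multiplicity formula and stable trace formula”, Amer. J. Math. 141(2019), no. 4, p. 1037–1085." / p0316:L13 "[Xu18] B. Xu – “L-packets of quasisplit GSp(2n) andGO(2n)”,Math. Ann.".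
-- C16 `arxiv-1508.03205v4/`: title p0001:L1-2 "arXiv:1508.03205v4  [math.NT]  19 Nov 2019ARTHUR PARAMETERS AND CUSPIDAL AUTOMORPHIC MODULES OF CLASSICAL GROUPS"; bibliography p0087:L40-42 "[3] Arthur, James The endoscopic classiﬁcation of representations: Orthogo nal and Symplectic groups. American Mathematical Society Colloquium Publica- tions, 61. 2013." / p0088:L13-15 "[11] Cogdell, J. W.; Kim, H. H.; Piatetski-Shapiro, I. I.; Shahidi, F. Functoriality for the classical groups . Publ. Math. Inst. Hautes ´Etudes Sci. No. 99 (2004), 163–233." / p0088:L31 "[18] Gan, Wee Teck; Ichino, Atsushi The Gross-Prasad conjecture and local theta"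
--   / p0089:L11 "[29] Heiermann, V. A note on Standard Modules and Vogan L-packets. Manuscripta" / p0090:L24-26 "[53] Kaletha, Tasho; Minguez, Alberto; Shin, Sug Woo; White, Paul-J amesEn- doscopic Classiﬁcation of Representations: Inner Forms of Unitary Groups . arXiv:1409.3731 (2014)." / p0091:L13-15 "[68] Mœglin, C.; Waldspurger, J.-L. La conjecture locale de Gross-Prasad pour les groupes sp´ eciaux orthogonaux: le cas g´ en´ eral. Sur les conjectures de Gross et Prasad. II. Ast´ erisque No. 347 (2012), 167–216." / p0091:L20-21 "[71] Mok, C. P. Endoscopic classiﬁcation of representations of quasi-spl it unitary groups. Mem. of AMS, 235 (2015), No. 1108.".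

/-- B31 v2 ⇐ THE BOOK (all ranks; inductions on n) ∧ B2 ∧ B5 ∧ B42 ∧ B101 ∧ C168 — tranche 41's premises at v2's places, plus v2's Theorem 2.2 (`arxiv-2209.03816v2/`).  THE BOOK: p0002:L19-21 "Given a local Arthur parameter ψas in (1.1), the local Arthur packet Π ψdeﬁned in [ Art13, Theo- rem 2.2.1 and formula (1.5.1)] is a ﬁnite multi-set of irredu cible representations of Gn, satisfying certain twisted endoscopic character identities. Arthur showed th at Πψconsists of unitary representations when" […] (next line in the `--` comment); p0002:L37-38 "Arthur showed that the map ψ↦→φψis injective and the local L-packet Π φψis contained in Π ψ(see [Art13, Proposition 7.4.1]). We say that a local L-parameter φ, hence the corresponding local L-packet" p0006:L28-36 "Finally, to specify the tempered representation π0in eachL-data, we recall Arthur’s classiﬁcation of tempered representations. Theorem 2.1 ([Art13, Theorem 1.5.1]) .Any irreducible tempered representation of Gnlies inΠψfor some tempered local Arthur parameter ψ.Moreover, if ψ1andψ2are two non-isomorphic tempered local Arthur parameters, then Πψ1∩Πψ2=∅. Finally, if one ﬁxes a choice of Whittaker datum for Gnandψis tempered, then there is a bijective map between the tempered local Arthur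 packet ΠψandˆSψ, the Pontryagin dual of the component group Sψ:=π0(Cent(im(ψ),ˆGn)/Z(ˆGn)Γ)." p0005:L12-14 "As a direct implication of Theorem 1.7, given a local Arthur packet Π ψ, there are no proper subsets providing stable distributions which are compatible with e ndoscopic transfers (for the compatibility properties, see [ Art13, Theorem 2.2.1(a), (2.2.3) and (2.2.4)]). This result has i ts own interests." p0037:L15 "ψ0,ζ, which lies in ˆSφψ0⊆ˆSψ0(see [LLS24]). Thusˆπ∈Πφ0by [Art13, Lemma 7.4.1]. This" […].  ROW C168 = [Mœ11b] (Mœglin, Adv. Math. 228 (2011), PROPOSITION 5.1 = the LOCAL statement typed in `Consumers54.MoeglinImage`): p0007:L38-41 "The following result of Mœglin reduces the construction of Π ψto the construction of Π ψ0of good parity. Theorem 2.2 ([Mœ11b, Proposition 5.1]) .With above notation, for any π∈Πψ0, the induced repre- sentationτψ1⋊πis irreducible, independent of the choice of ψ1, and Πψ={τψ1⋊π|π∈Πψ0}." — used by Definition 3.8 (ψ^max(π), ψ^min(π) « as in Theorem 2.2 ») and Theorem 3.5 p0011:L57-58 "Therefore, together with Theorem 2.2, the above theorem gives a way to compute Ψ(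 π). A more precise formula or algorithm can be found in [ HLL22, Theorem 7.4]."  ROW B101 = [HLL22]: p0003:L42-43 "The proof of Theorem 1.4, which implies Part (1) of Theorem 1.3, relies on certain operators intro- duced in [ HLL22] (see §3.1and Deﬁnition 3.10)." p0009:L25-27 "deﬁnition of extended multi-segments and various operator s on them. Then we recall the construction of Ψ(π) given in [ HLL22] and [Ato23] and its structure studied in [ HLL22], especially the distinguished membersψmax(π) andψmin(π). Finally, we recall deﬁnition of the operator ordering ≥O." p0011:L48-49 "One of the main results of [ HLL22] is the following theorem. Theorem 3.5 ([HLL22,§6], [Ato23]).Supposeπ∈Πgp" […] p0012:L28-29 "Proposition 3.9 ([HLL22,§10]).Letπ∈ΠA(Gn). (1)φπis of Arthur type if and only if π∈Πφψmax(π)." […] p0014:L8-11 "Theorem 3.14 ([HLL22,§11]).LetGnbeSp2nor splitSO2n+1andπ∈ΠA(Gn). The parameters ψmax(π)andψmin(π)are the unique elements in Ψ(π)such that for any ψ∈Ψ(π), the following inequality holds ψmax(π)≥Oψ≥Oψmin(π)." […].  ROW B5 = [Ato22] (Atobe, Crelle 790 (2022)): p0009:L29 "Deﬁnition 3.1 ([Ato22,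 Deﬁnition 3.1]) .(Extended multi-segments)" […] p0010:L40-42 "Atobeshowedthatlocal Arthurpackets ofgoodparitycanbec onstructedbyextendedmulti-segments as follows. Theorem 3.2 ([Ato22, Theorem 3.4]) .Supposeψ=⨁" […] p0010:L36-37 "(5)For each extended multi-segment E, we letπ(E)denote the representation associated with Eas in[Ato22,§3.2](or see[HLL22, Deﬁnition 3.4] ).π(E)is either irreducible or zero. We denote" […].  ROW B42 = [AM23] (Atobe – Mínguez, Compos. Math. 159 (2023)): p0008:L28 "Theorem 2.5 ([Jan14, Lemma 3.1.3], [ AM23, Proposition 6.1, Theorem 7.1]) .Letρbe an irreducible" […] p0009:L5 "Proof.This follows from the explicit formula in [ AM23, Theorem 7.1]. □" p0009:L15-17 "For Sp2n(F) and split SO 2n+1(F), Atobe and M´ ınguez showed that the Aubert-Zelevinsky inv olution is compatible with derivatives ([ AM23, Proposition 3.9]), and they give an algorithm to compute th e involution in terms of the L-data ([AM23, Algorithm 4.1])."  ROW B2 = [Xu17] (B. Xu, Canad. J. Math. 69 (2017)): p0038:L2-5 "First, werecallthefollowingtheoremwhichstatesthatthe Aubert-Zelevinskyinvolutioniscompatible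 with endoscopic transfer for quasi-split classical groups . Theorem 7.1 ([Xu17,§A]).LetG = Sp2nor quasi-split SOnand letψ∈Ψ+(G). Then Πˆψ={ˆπ|π∈Πψ}." (and p0037:L25 "Hypotheses 6.8(1) is veriﬁed in [ Xu17,§A] (see Theorem 7.1) and Working Hypotheses 6.8(2) is Lemma" […]).  [Ato23] (Atobe, Crelle 804 = row B89) is cited as an alternative source in Theorem 3.5 and for algorithms (p0002:L45-47, p0011:L54), not as a premise; Mœglin [Mœ06a] – [Mœ11a], [Mœ09b, Proposition 4.1] (its sentence names a conj.: `--` comment) second-hand through B2 / B5, as in tranche 41; [CFMMX22], [ABV92], [Jan14], [MR17], [BP16], [GI16], [GP92]: Arthur-free or cited for comparison; [LLS24] (Liu – Lo – Shahidi 2024) and [Art13, Lemma 7.4.1] at p0037:L15 belong to §6.2, outside the field.  STATUS SENTENCE: none (G-i).  Premises: the book (all ranks), rows B2, B5, B42, B101, C168. [cite: HazeltineLiuLoZhang2025Closure, §1 (p0002:L19-21, L37-38; p0003:L42-43; p0005:L12-14), §2 (p0006:L28-36; p0007:L38-41; p0008:L28; p0009:L5, L15-17), §3 (p0009:L25-29;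 p0010:L36-42; p0011:L48-58; p0012:L19-29; p0014:L8-11), §6 (p0037:L15, L25), §7 (p0038:L2-5) (arXiv v2); Arthur2013, Thms 1.5.1, 2.2.1, Prop. 7.4.1, Lemma 7.4.1, as [Art13]; Moeglin2011Image, Prop. 5.1, as [Mœ11b]; HazeltineLiuLo2022, §§6, 10, 11, as [HLL22]; Atobe2022, Def. 3.1, Thm 3.4, as [Ato22]; AtobeMinguez2023, Prop. 6.1, Thm 7.1, Prop. 3.9, Alg. 4.1, as [AM23]; Xu2017CJM, §A, as [Xu17]] -/
def E_HLLZclosureV2 : Prop :=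
  (∀ N, ν.Everything N) → c₂.XuMoeglinParam → c₅.AtobeApackets → c₅.AtobeMinguez → c₂₆.HLL → c₅₄.MoeglinImage → c₁₂₅.HLLZclosureV2

/-- B44 v2 ⇐ A8 ∧ B24 — tranche 53's premises at v2's places (`arxiv-1906.00725v2/`; the paper cites Arthur's theory through the authors' [MR20] = row A8 `Consumers2.MoeglinRenard` (J. Eur. Math. Soc. 22 (2020)) and [MR19] = row B24 `Consumers53.MRunitaryReal` (Pacific J. Math. 299 (2019)), and the book nowhere).  p0003:L26-29 "Cette réalisation des séries discrètes de Xen termes d’induction cohomologique permet, en utilisant nos travaux antérieurs ( cf.[MR20 ], [MR19 ]) sur les paquets d’Arthur des groupes classiques réels, de fournir pour chaque série discrète πdeXun paramètre d’Arthur explicite ψπtel queπsoit dans le paquet d’Arthur correspondant Π(G,ψπ). On rappelle dans la section" […]; §3.1 p0011:L50 "3.1. Paramètres d’Arthur de bonne parité. — Ce qui suit est tiré de [ MR20 ] auquel" […]; Proposition 3.1's lead-in p0013:L42-45 "degetπLune représentation de Lvériﬁant les hypothèses de la déﬁnition 2.5. Lorsque Gest un groupe classique (c’est-à-dire dans cet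 article, un grou pe général linéaire, un groupe unitaire ou un groupe spécial orthogonal), les résultats de [ MR20 ] et [MR19 ] montrent que l’on a le résultat suivant, déjà bien connu dans le cas des groupes lin éaires généraux."; §8 p0004:L31-36 "section 8 pour une discussion précise au cas par cas. Rappelo ns que la théorie d’Arthur attache à toute représentation πdeGdans un paquet Π(G,ψ)de paramètre ψun certain invariant ǫ(π), qui est dans les cas qui nous occupent ici un caractère du gro upeA(ψ)des composantes connexes du centralisateur de ψdansG∨(lesA(ψ)sont ici des 2-groupes ﬁnis). Les résultats de [MR20 ], [MR19 ] déterminent (un choix de donnée de Whittaker pour une forme intérieure pure quasi-déployée de Gétant ﬁxée) ces caractères ǫ(π). Il s’avère que l’on peut lire sur le" p0028:L12 "[MR19 ], [MR20 ] que lesǫ(π)sont de dimension 1, c’est-à-dire, pour tout π∈Π(ψ),ǫ(π)∈" […] p0029:L42 "résultat suivant découle des calculs des ǫ(π)∈ˆA(ψ)dans [MR19 ] pourπ∈Π(ψ). On écrit" […] p0030:L38 "Remarque 8.3 . — Les résultats de multiplicité un [ MR19 ] impliquent donc ici que le spectre" […].  Oshima – Matsuki, Flensted-Jensen, Schlichtkrull,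 Vogan (Théorème 2.7), Sakellaridis – Venkatesh [SV17], Knop – Schalke [KS17], Knapp – Vogan, Adams – Barbasch – Vogan: Arthur-free, absorbed.  STATUS SENTENCE: none (G-i).  Premises: `MoeglinRenard`, `MRunitaryReal`. [cite: MoeglinRenard2020Symetriques, introduction (p0003:L26-29, p0004:L31-36), §3.1 (p0011:L50), §3.2 (p0013:L42-45), §8 (p0028:L12, p0029:L42, p0030:L38) (arXiv v2); MoeglinRenard2020, as [MR20]; MoeglinRenard2019Unitaires, as [MR19]] -/
def E_MRsymmetricV2 : Prop := c₂.MoeglinRenard → c₅₃.MRunitaryReal → c₁₂₅.MRsymmetricV2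

/-- C16's Theorem 5.1 = B.2 AS PRINTED ⇐ THE BOOK ∧ MOK ∧ KMSW (PROVED SCOPE: the parameters are generic) ∧ THE CHAPTER-9 LEAF — the premises of tranche 8's `E_JZmain`, at Appendix B's places (`arxiv-1508.03205v4/`).  THE CLASSIFICATIONS the appendix works inside (§2.2): p0013:L21-24 "We recall from the work of Arthur ([3]), the work of Mok ([71]) and the work of Kaletha, Minguez, Shin, and White ([53]) the theory for the (special) orthogonal groups and the unitary groups consider ed in this paper." […] p0016:L23-29 "The following is a simpliﬁed version of the endoscopic classiﬁcation for classical groups established in [3], [71], and [53]. Theorem 2.1 (Endoscopic Classiﬁcation) .For anyπ∈ Adisc(Gn), there is aGn-relevant global Arthur parameter ψ∈˜Ψ2(G∗ n,ξ), such thatπbelongs to the global Arthur packet, ˜Πψ(Gn), attached to the global Arthur parameter ψ." and the local L-functions (§4.4) p0045:L13-14 "and to have generic global Arthur parameters ([3, Chapter 9] and [53]), we may follow [3], [71] and [53] to deﬁne the local L-functions in (4.47)" […] ([3] = the book, [71] = Mok, [53] = KMSW, arXiv:1409.3731; « [3, Chapter 9] » = the register's leaf `Consumers8.InnerTwists` for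 the non-quasi-split special orthogonal H_m, as in tranche 8).  THE PROOF OF THEOREM B.2: p0086:L2-9 "Proof.First of all, the local L-packet˜Πφ+(Hm) has a generic member σ◦([3] and [71]) when Hm=H∗ mis quasisplit. If σis generic, the proposition follows from Theorem 11.1 in [11]. Assume now that σis not generic. For such a generic local L-packet ˜Πφ+(Hm), by Proposition B.1, the standard modules as displayed in (B.2) areirreducible. Thisisthekey point forustoapplytheargumen t in [11] in the proof of this proposition." […] p0086:L22-24 "andallτ(φi) andσ0areirreducible, unitary, generic, and tempered. By PropositionB.1, each σin˜Πφ+(Hm)isofform(B.2)withtheexponents satisfying (B.5)." […] p0087:L12-17 "tempered. Since φ0is a generic parameter, there is a generic represen- tationσ◦ 0in the tempered local L-packet˜Πφ0(Hn0). Hence we have the identity of local L-factors: L(s,τ×σ0) =L(s,τ×σ◦ 0)."  PROPOSITION B.1's sources p0085:L18-23 "Proof.IfFis non-archimedean, this proposition is proved by Mœglin and Waldspurger in [68] for orthogonal groups, by Gan and Ichino in [18, Proposition 9.1], and by Heiermann in [29] for general reductive groups. IfFis archimedean, it is a special case of Theorem 1.24 in the book by Adams, Barbasch and Vogan ([1]).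 More details can be foun d in Chapters 14 and 15 of [1]. □" — [68] Mœglin – Waldspurger (Astérisque 347), [18] = Gan – Ichino, Invent. Math. 206 (2016) = row B18, whose Proposition 9.1 is there « the following result of Heiermann [hei], which extends a result of M --Waldspurger [mw] for special orthogonal groups and symplectic groups » (corpus TeX `paper:arxiv-1409.6824` p0030:L32, verbatim with its rendering gap; Proposition 9.1 at p0030:L34-38), [29] Heiermann, [1] Adams – Barbasch – Vogan: published, Arthur-free, absorbed (B18 is the conduit of Heiermann's theorem here, not a premise); [11] Cogdell – Kim – Piatetski-Shapiro – Shahidi (Theorem 11.1), [55] Kim, [66] Mœglin – Waldspurger, [82] Waldspurger (Prop. IV.2.1), [10], [79] Tadić, [80] Vogan: Arthur-free, absorbed.  STATUS SENTENCE: none in §5 / Appendix B.  Premises: the book (all ranks), Mok (all ranks), KMSW's proved scope, `InnerTwists`. [cite: JiangZhang2020, §2.2 (p0013:L21-24; p0016:L23-29), §4.4 (p0045:L13-14), App. B (p0084:L37-46; p0085:L13-24; p0086:L2-24; p0087:L8-33) (arXiv v4 pagination); Arthur2013, as [3]; Mok2012, as [71]; KalethaMinguezShinWhite2014, as [53]; GanIchino2016,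 Prop. 9.1, as [18]] -/
def E_JZnlio : Prop := (∀ N, ν.Everything N) → (∀ N, μ.Everything N) → (∀ N, κ.Scope N) → c₈.InnerTwists → c₁₂₅.JZnlio

/-- C16's Theorem B.2 FOR UNITARY GROUPS ⇐ MOK ∧ KMSW (PROVED SCOPE): the same places read for H*_m = U_{E/F}(m) quasi-split and H_m a pure inner form — the generic member σ° of Π̃_φ+(H*_m) from « [71] » = Mok, the L-packets Π̃_φ(H_m) of the pure inner forms and their L-factors from « [71] and [53] » (§2.2, §4.4), the tempered/generic parameters lying in KMSW's proved scope (`KMSW2014.Nodes.Scope`); the book ([3]) enters Appendix B only for symplectic / orthogonal H_m and the Chapter-9 leaf only for non-quasi-split orthogonal H_m, both outside this instance.  This is the support row C35 already has (tranche 34 `E_HaanGGP`, tranche 124 `E_HaanGGPv7`: Mok ∧ KMSW scope), so C35 v7's citation « [35, Theorem B.2] » adds no premise to row C35 (theorem `c35_and_its_theoremB2_of_same_inputs`). [cite: JiangZhang2020, Thm B.2 for unitary H_m, with App. B (p0084:L38-44; p0086:L2-4) and §2.2 (p0013:L21-24); Mok2012, as [71]; KalethaMinguezShinWhite2014, as [53];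 Haan2023, Remark 1.1 (iii) (arXiv v7 p0005:L9-11, L26-27), the consumer] -/
def E_JZnlioU : Prop := (∀ N, μ.Everything N) → (∀ N, κ.Scope N) → c₁₂₅.JZnlioU

/-- C16, bookkeeping edge: the unitary-group instance is a case of the printed theorem (H*_m ranges over the quasi-split unitary AND special orthogonal groups of §2, p0013:L21-24 "We recall from the work of Arthur ([3]), the work of Mok ([71]) and the work of Kaletha, Minguez, Shin, and White ([53]) the theory for the (special) orthogonal groups and the unitary groups consider ed in this paper."). [cite: JiangZhang2020, Thm B.2 (p0085:L38-45) ⊇ its unitary case (bookkeeping edge)] -/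
def E_JZnlioInstance : Prop := c₁₂₅.JZnlio → c₁₂₅.JZnlioU

/-- C36 v3 ⇐ THE BOOK (by number, all ranks — the global parameters ψ = ⊞ π_i[d_i] of G* = SO(V, q) quasi-split run through every GL_N) ∧ A3 ∧ B1 ∧ THE NODE `ZhuHyp202` (= Hypothesis 9.1.2) — tranche 69's premises at v3's places plus the direct use of [AMR18] (`arxiv-1801.09404v3/` under `HOME/pub-arthur-down-g52/primaries/`).  THE FRAME (§9.1): p0249:L19-29 "Recent developments have seen the proof of variations of these hypotheses in spe- cific instances. For the groups that are relevant to this paper, Arthur [ Art13 ] has established (1) and (2) for quasi-split special orthogonal groups over number fields, and Ta¨ ıbi [ Ta¨ı19] has generalized (1) to some inner forms of these groups (and under a regular algebraic assumption). Among the inputs to Ta¨ ıbi’s work are the theory of rigid inner forms established by Kaletha [ Kal16, Kal18 ] and results of Arancibia– Moeglin–Renard [ AMR18 ] on archimedean Arthur packets. (For the special orthog- onal groups of interest to us, only the special case of Kaletha’s theory, namely that of pure inner forms, is needed.) We mention that Arthur’s work [ Art13 ] depends on the stabilization of the twisted trace formula as a hypothesis, and the latter has been established by Moeglin–Waldspurger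 [ MW17 ].(1)It is thus possible to combine" (footnote (1) p0249:L30 "(1)However, see footnote 3 on p. 3." → footnote (3) p0013:L42-43 "(3)The results in [ Art13 ] are contingent on the release of several upcoming papers, including the reference [A25], which have not appeared as of the time of writing.") p0250:L2-4 "Corollary 8.17.5 with the results from [ Art13 ] and [ Ta¨ı19] to obtain an unconditional description of IH∗(ShK,V) in certain special cases. In the following we carry this out, for the special cases described in Lemma 9.4.2."  THE NODE: p0250:L5 "In the sequel, we shall assume the following hypothesis." […] p0250:L10-12 "This hypothesis essentially follows from Kottwitz’s stabilization of the trace formula with stable cuspidal test functions at infinity in his unpublished notes. Recently an alternative proof has been given by Z. Peng [ Pen19 ]. Let us make some comments" […] (and p0014:L33-34 "A self-contained proof of this formula for STH(fH), from a different point of view, is given in a recent paper by Z. Peng [ Pen19 ]."; Peng 2019 is published and outside the three DAGs — recorded, no supply edge typed, as in D-DN-g52-5: the text assumes the hypothesis) p0286:L33 "We also keep assuming Hypothesis 9.1.2 without further mentioning."  THE BOOK BY NUMBER (§9.2 « Review of Arthur’s results » and after): p0252:L19-20 "We loosely follow [ Ta¨ı19,§2] to recall some of the main constructions and results in [Art13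 ]. We fix a quasi-split quadratic space ( V,q) over Q, of dimension dand" […] p0252:L27 "GLNoverQ. Arthur [ Art13 , Thm. 1.4.1] associates to πa quasi-split orthogonal or" […] p0258:L12 "v). In [ Art13 , Thm. 2.2.1], Arthur gives a characterization" […] p0263:L49 "[Art13 , Lem. 3.3.1, Prop. 3.4.1, Thm. 4.1.2]:" p0281:L32-33 "§10]. Both references rely on Arthur’s identity ϵψ′(sψ′) =ϵψ(sψs), which is known in our case by [ Art13 , Lem. 4.4.1]." p0289:L38-41 "Recall that as a fundamental construction in [ Art13 ], we have a canonical injection ˜Ψ(G∗)−→˜CA(G∗) (9.8.4.1) ψ↦−→c(ψ) whose well-definedness is guaranteed by [ Art13 , Thm. 1.3.2, Thm. 1.4.1]. This map" […] p0282:L27-28 "of˜Ψ(H) independently of ( f∞,p,a). By [ Art13 , Thm. 1.3.2, Lem. 3.3.1], we need only check that fHhas a Hecke type (see [Art13 , p. 129]) that is independent of" […].  ROW A3 = [Taï19] (`Consumers.TaibiInner`): p0014:L6-9 "condition. Arthur’s work has been generalized to limited cases of inner forms by Ta¨ ıbi [ Ta¨ı19] (building on earlier work of Kaletha [ Kal18,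 Kal16 ] and Arancibia– Moeglin–Renard [ AMR18 ], among others). We combine Theorem 1 with Arthur’s and Ta¨ ıbi’s work to obtain the following theorem. Here we state it only for odd nfor" […] p0264:L26 "We recall Ta¨ ıbi’s parametrization in [ Ta¨ı19] of the Arthur packets for Gvunder special" […] p0265:L12 "We summarize in the next proposition the construction in [ Ta¨ı19,§3.3]." p0268:L37-38 "(V,q) overFwhose dimension is dand discriminant is δ. Thus the lemma is just a reformulation of parts 1,2 of [ Ta¨ı19, Prop. 3.1.2], in the special case where the base" […] p0281:L29-30 "for allψ∈˜Ψ(G∗)Vands∈Sψ. This step is identical to the corresponding step in the proof of [ Ta¨ı19, Thm. 4.0.1]. Without the extra complication in the even case (i.e.," […].  ROW B1 = [AMR18] (`Consumers.AMR`, Ann. Fac. Sci. Toulouse 27 (2018)): p0267:L22-23 "With the above modification, we summarize the results in [ Ta¨ı19,§§3.2.2–3.2.3] together with a comparison result in [ AMR18 ] as follows." p0268:L12-13 "the distribution that appears in [ AJ87 , Thm. 2.13]. With this understanding, part (1) is the same as [ AJ87 , Thm. 2.13], and part (2) is proved in [ AMR18 ]."  ROW A7 = [Xu18, Appendix] (B.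 Xu, Math. Ann. 370 (2018) = `Consumers.XuGSp`) for one branch of Lemma 9.8.3 only (p0287:L32-34, a sentence naming a conj.: `--` comment), not a premise of the typed statements; Caraiani [Car12] / [BLGGT14] for the other branches (p0288:L6-8 "self-dual, and by the work of a long list of authors culminating in Caraiani’s work [Car12 , Thm. 1.2], ( π′ i)vis essentially tempered for all finite places v(cf. [BLGGT14 ," […]); [Kot90], Morel, Pink, Looijenga – Rapoport, Saper – Stern, [Art01–03], [Art96]: Arthur-free or upstream, absorbed.  STATUS: FLAGGED — footnote (3) names [A25] (p0013:L42-43).  Premises: the book (all ranks), `TaibiInner`, `AMR`, `ZhuHyp202`. [cite: Zhu2018FrobeniusHecke, §1 (p0013:L34-43; p0014:L6-9, L29-34), §9.1 (p0249:L19-30; p0250:L2-12), §9.2 (p0252:L19-28; p0258:L12; p0263:L49), §9.3 (p0264:L26; p0265:L12; p0267:L22-23; p0268:L12-13), §9.4 (p0268:L30-38; p0269:L5-7), §9.6 (p0281:L29-33; p0282:L27-28), §9.8 (p0286:L33; p0287:L32-34; p0288:L6-8; p0289:L38-41) (arXiv v3); Arthur2013, Thms 1.3.2, 1.4.1, 1.4.2,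 2.2.1, 4.1.2, Lem. 3.3.1, 4.4.1, Props 3.4.1, 4.1.1, as [Art13]; Taibi2018, Props 3.1.2, 3.2.5, 3.3.1, Thm 4.0.1, as [Taï19]; ArancibiaMoeglinRenard2015, as [AMR18]] -/
def E_ZhuIHv3 : Prop := (∀ N, ν.Everything N) → c.TaibiInner → c.AMR → c₆₉.ZhuHyp202 → c₁₂₅.ZhuIHv3

/-- The hundred-and-twenty-fifth tranche of implications. [cite: HazeltineLiuLoZhang2025Closure, Thms 1.3, 1.4, 1.7, 3.15 (arXiv v2); MoeglinRenard2020Symetriques, Prop. 3.1, Cor. 4.2 (arXiv v2); JiangZhang2020, Thm 5.1 = Thm B.2; Zhu2018FrobeniusHecke, Thms 9.7.5, 9.8.5 (arXiv v3) (each edge's source in its own docstring)] -/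
structure Implications125 : Prop where
  hllzClosureV2 : E_HLLZclosureV2 ν c₂ c₅ c₂₆ c₅₄ c₁₂₅
  mrSymmetricV2 : E_MRsymmetricV2 c₂ c₅₃ c₁₂₅
  jzNlio : E_JZnlio ν μ κ c₈ c₁₂₅
  jzNlioU : E_JZnlioU μ κ c₁₂₅
  jzNlioInstance : E_JZnlioInstance c₁₂₅
  zhuIHv3 : E_ZhuIHv3 ν c c₆₉ c₁₂₅

variable {ν μ κ c c₂ c₅ c₈ c₂₆ c₅₃ c₅₄ c₆₉ c₁₂₅} {c₄ : Consumers4} {c₁₁ : Consumers11} {c₁₃ : Consumers13} {c₃₃ : Consumers33} {c₃₄ : Consumers34}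
  {c₄₁ : Consumers41} {c₆₅ : Consumers65}

/-- B31 v2 given the book at all ranks and the rows B2, B5, B42, B101, C168 (C168 granted: its own support is tranche 54's `adamsLine_of_node`). [cite: HazeltineLiuLoZhang2025Closure, Thms 1.3, 1.4, 1.7, 3.15 (arXiv v2) (bookkeeping proved here)] -/
theorem hllzClosureV2_of_book_and_rows (U : Implications125 ν μ κ c c₂ c₅ c₈ c₂₆ c₅₃ c₅₄ c₆₉ c₁₂₅) (hν : ∀ N, ν.Everything N)
    (h₂ : c₂.XuMoeglinParam) (h₅ : c₅.AtobeApackets) (h₄₂ : c₅.AtobeMinguez) (h₁₀₁ : c₂₆.HLL) (h₁₆₈ : c₅₄.MoeglinImage) :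
    c₁₂₅.HLLZclosureV2 :=
  U.hllzClosureV2 hν h₂ h₅ h₄₂ h₁₀₁ h₁₆₈

/-- B31 v2 from the book's inputs along B2 ⇐ book, B5 ⇐ book ∧ B2 ∧ B42, B42 ⇐ book, B101 ⇐ book ∧ B5 (tranches 2, 5, 26, as tranche 41's
`hllzClosure_of_leaves`), with C168 granted. [cite: HazeltineLiuLoZhang2025Closure, Thm 1.3 (arXiv v2) (bookkeeping proved here)] -/
theorem hllzClosureV2_of_leaves_and_C168 (U : Implications125 ν μ κ c c₂ c₅ c₈ c₂₆ c₅₃ c₅₄ c₆₉ c₁₂₅) (J : Implications2 ν μ κ c c₂)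
    (V : Implications5 ν μ κ c c₂ c₅) (Y : Implications26 ν μ c c₅ c₁₁ c₂₆) (A : BookInputs ν) (h₁₆₈ : c₅₄.MoeglinImage) :
    c₁₂₅.HLLZclosureV2 :=
  hllzClosureV2_of_book_and_rows U A.everything (xuMoeglinParam_of_leaves J A) (atobeApackets_of_leaves J V A)
    (atobeMinguez_of_leaves V A) (hll_of_leaves Y J V A) h₁₆₈

/-- B31 v2 in conditional form, 2026 (no status sentence): granting the book's internal derivations, its supply edges, every published input and C168's
local statement, Theorems 1.3 / 1.4 / 1.7 / 3.15 — statements about the book's packets of Sp_{2n}(F), split SO_{2n+1}(F) — are conditional on the book's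
2024–2026 preprint layer and on the general and the non-standard weighted fundamental lemmas; no Mok, no KMSW. [cite: HazeltineLiuLoZhang2025Closure, Thm 1.3 (arXiv v2) (bookkeeping proved here)] -/
theorem hllzClosureV2_conditional_form (U : Implications125 ν μ κ c c₂ c₅ c₈ c₂₆ c₅₃ c₅₄ c₆₉ c₁₂₅) (J : Implications2 ν μ κ c c₂)
    (V : Implications5 ν μ κ c c₂ c₅) (Y : Implications26 ν μ c c₅ c₁₁ c₂₆) (B : ν.BookEdges) (S : ν.SupplyEdges) (P : ν.PublishedLeaves)
    (h₁₆₈ : c₅₄.MoeglinImage) : ν.PreprintLeaves2026 → ν.WFL_general → ν.WFL_nonstandard → c₁₂₅.HLLZclosureV2 :=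
  fun hQ h6 h7 => hllzClosureV2_of_leaves_and_C168 U J V Y ⟨B, S, P, hQ, ⟨h6, h7⟩⟩ h₁₆₈

/-- ROW B31, THE TWO TEXT STATES SIDE BY SIDE from the book, B2, B5, B42, B101 and (for v2) C168: Theorems 1.9 / 1.12 / 1.15 / 1.16 with the §5 algorithms
(tranche 41, corpus TeX of v1) and Theorems 1.3 / 1.4 / 1.7 / 3.15 (arXiv v2, 2024). [cite: HazeltineLiuLoZhang2025Closure, Thms 1.9, 1.12, 1.15, 1.16 (v1) vs Thms 1.3, 1.4, 1.7, 3.15 (arXiv v2) (bookkeeping proved here)] -/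
theorem b31_two_text_states (T : Implications41 ν μ κ c₂ c₅ c₂₆ c₄₁) (U : Implications125 ν μ κ c c₂ c₅ c₈ c₂₆ c₅₃ c₅₄ c₆₉ c₁₂₅)
    (hν : ∀ N, ν.Everything N) (h₂ : c₂.XuMoeglinParam) (h₅ : c₅.AtobeApackets) (h₄₂ : c₅.AtobeMinguez) (h₁₀₁ : c₂₆.HLL)
    (h₁₆₈ : c₅₄.MoeglinImage) : c₄₁.HLLZclosure ∧ c₁₂₅.HLLZclosureV2 :=
  ⟨T.hllzClosure hν h₂ h₅ h₄₂ h₁₀₁, U.hllzClosureV2 hν h₂ h₅ h₄₂ h₁₀₁ h₁₆₈⟩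

/-- B44 v2 given rows A8 and B24. [cite: MoeglinRenard2020Symetriques, Prop. 3.1, Cor. 4.2 (arXiv v2) (bookkeeping proved here)] -/
theorem mrSymmetricV2_of_rows (U : Implications125 ν μ κ c c₂ c₅ c₈ c₂₆ c₅₃ c₅₄ c₆₉ c₁₂₅) (hA8 : c₂.MoeglinRenard) (h₂₄ : c₅₃.MRunitaryReal) :
    c₁₂₅.MRsymmetricV2 :=
  U.mrSymmetricV2 hA8 h₂₄

/-- B44 v2 FROM THE INPUTS OF ALL THREE DAGS along B24 ⇐ Mok ∧ KMSW in full (both unwritten sequels) ∧ [AMR] ∧ B68 ∧ the book ∧ A8 (tranche 53's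
`mrUnitaryReal_of_inputs`), with A8, [AMR]'s unitary statement and A8-p granted. [cite: MoeglinRenard2020Symetriques, Cor. 4.2 (arXiv v2) (bookkeeping proved here)] [claim: KalethaMinguezShinWhite2014, under-review] -/
theorem mrSymmetricV2_of_inputs (U : Implications125 ν μ κ c c₂ c₅ c₈ c₂₆ c₅₃ c₅₄ c₆₉ c₁₂₅) (W : Implications53 ν μ κ c₂ c₄ c₁₃ c₅₃) (A : BookInputs ν)
    (M : MokInputs μ) (K : KMSWInputs μ κ) (Q : κ.UnwrittenSequels) (hAMRu : c₄.AMRunitary) (hA8 : c₂.MoeglinRenard)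
    (hMRo : c₁₃.MRpadicOrth) : c₁₂₅.MRsymmetricV2 :=
  mrSymmetricV2_of_rows U hA8 (mrUnitaryReal_of_inputs W A M K Q hAMRu hA8 hMRo)

/-- ROW B44, THE TWO TEXT STATES SIDE BY SIDE from A8 and B24: « Théorème 2.3 » (tranche 53, corpus TeX of v1) and Proposition 3.1 / Corollaire 4.2 / §8
(v2). [cite: MoeglinRenard2020Symetriques, Thm 2.3 (v1) vs Prop. 3.1, Cor. 4.2 (arXiv v2) (bookkeeping proved here)] -/
theorem b44_two_text_states (W : Implications53 ν μ κ c₂ c₄ c₁₃ c₅₃) (U : Implications125 ν μ κ c c₂ c₅ c₈ c₂₆ c₅₃ c₅₄ c₆₉ c₁₂₅)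
    (hA8 : c₂.MoeglinRenard) (h₂₄ : c₅₃.MRunitaryReal) : c₅₃.MRsymmetric ∧ c₁₂₅.MRsymmetricV2 :=
  ⟨W.symmetric hA8 h₂₄, U.mrSymmetricV2 hA8 h₂₄⟩

/-- C16's Theorem 5.1 = B.2 as printed, from the inputs of the three DAGs (KMSW in its proved scope) and the Chapter-9 leaf. [cite: JiangZhang2020, Thm 5.1 = Thm B.2 (bookkeeping proved here)] -/
theorem jzNlio_of_inputs (U : Implications125 ν μ κ c c₂ c₅ c₈ c₂₆ c₅₃ c₅₄ c₆₉ c₁₂₅) (A : BookInputs ν) (M : MokInputs μ) (K : KMSWInputs μ κ)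
    (h9 : c₈.InnerTwists) : c₁₂₅.JZnlio :=
  U.jzNlio A.everything M.everything (K.scope M) h9

/-- C16's Theorem B.2 for unitary groups, from Mok's and KMSW's inputs. [cite: JiangZhang2020, Thm B.2 for unitary H_m (bookkeeping proved here)] -/
theorem jzNlioU_of_inputs (U : Implications125 ν μ κ c c₂ c₅ c₈ c₂₆ c₅₃ c₅₄ c₆₉ c₁₂₅) (M : MokInputs μ) (K : KMSWInputs μ κ) : c₁₂₅.JZnlioU :=
  U.jzNlioU M.everything (K.scope M)

/-- C16's Theorem B.2 for unitary groups, the second road: from the printed theorem's inputs through the instance edge (strictly more premises — the book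
and the Chapter-9 leaf — than the direct edge; the kernel records both). [cite: JiangZhang2020, Thm B.2 (bookkeeping proved here)] -/
theorem jzNlioU_of_printed (U : Implications125 ν μ κ c c₂ c₅ c₈ c₂₆ c₅₃ c₅₄ c₆₉ c₁₂₅) (A : BookInputs ν) (M : MokInputs μ) (K : KMSWInputs μ κ)
    (h9 : c₈.InnerTwists) : c₁₂₅.JZnlio ∧ c₁₂₅.JZnlioU :=
  have p := jzNlio_of_inputs U A M K h9
  ⟨p, U.jzNlioInstance p⟩

/-- C16's Theorem B.2 for unitary groups in conditional form, 2026, as tranche 34's `haanGGP_conditional_form`: granting Mok's and KMSW's internal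
derivations, supply edges, published leaves and KMSW's import of Mok, it rests on Mok's 2024–2026 preprint layer and Mok's copies of the general and the
non-standard weighted fundamental lemmas (KMSW's general lemma being Mok's, `E_SameWFL`); nothing of KMSW's unwritten sequels. [cite: JiangZhang2020, Thm B.2 for unitary H_m (bookkeeping proved here)] [claim: KalethaMinguezShinWhite2014, under-review] -/
theorem jzNlioU_conditional_form (U : Implications125 ν μ κ c c₂ c₅ c₈ c₂₆ c₅₃ c₅₄ c₆₉ c₁₂₅) (D1 : KMSW2014.E_ImportMok μ κ)
    (D3 : KMSW2014.E_SameWFL μ κ) (MB : μ.SectionEdges) (MS : μ.SupplyEdges) (MP : μ.PublishedLeaves) (KB : κ.ChapterEdges) (KS : κ.SupplyEdges)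
    (KP : κ.PublishedLeaves) : μ.PreprintLeaves2026 → μ.WFL_general → μ.WFL_nonstandard → c₁₂₅.JZnlioU :=
  fun hMQ m6 m7 => jzNlioU_of_inputs U ⟨MB, MS, MP, hMQ, ⟨m6, m7⟩⟩ ⟨D1, KB, KS, KP, ⟨D3 m6⟩⟩

/-- ROW C35 AND THE THEOREM IT CITES, FROM THE SAME INPUTS: tranche 34's edge for C35 (Mok ∧ KMSW scope) already yields C16's Theorem B.2 for unitary groups —
the citation « [35, Theorem B.2] » of C35 v7 enlarges C35's support by nothing. [cite: Haan2023, Main Theorem with Remark 1.1 (iii); JiangZhang2020, Thm B.2 (bookkeeping proved here)] -/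
theorem c35_and_its_theoremB2_of_same_inputs (T : Implications34 μ κ c₃₃ c₃₄) (U : Implications125 ν μ κ c c₂ c₅ c₈ c₂₆ c₅₃ c₅₄ c₆₉ c₁₂₅)
    (hμ : ∀ N, μ.Everything N) (hκ : ∀ N, κ.Scope N) : c₃₄.HaanGGP ∧ c₁₂₅.JZnlioU :=
  ⟨T.haanGGP hμ hκ, U.jzNlioU hμ hκ⟩

/-- ROW C16, THE PRINTED THEOREMS SIDE BY SIDE: tranche 8's Theorems 5.3 / 5.7 (`JZmain`) and Theorem 5.1 = B.2 (`JZnlio`) from the same four premises.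
[cite: JiangZhang2020, Thms 5.3, 5.7 vs Thm 5.1 (bookkeeping proved here)] -/
theorem c16_printed_theorems_of_inputs (X : Implications8 ν μ κ c₈) (U : Implications125 ν μ κ c c₂ c₅ c₈ c₂₆ c₅₃ c₅₄ c₆₉ c₁₂₅) (A : BookInputs ν)
    (M : MokInputs μ) (K : KMSWInputs μ κ) (h9 : c₈.InnerTwists) : c₈.JZmain ∧ c₁₂₅.JZnlio :=
  ⟨X.jzMain A.everything M.everything (K.scope M) h9, jzNlio_of_inputs U A M K h9⟩

/-- C36 v3 given the book at all ranks, rows A3 and B1, and the node. [cite: Zhu2018FrobeniusHecke, Thms 9.7.5, 9.8.5, Cors 9.8.8, 9.8.10 (arXiv v3) (bookkeeping proved here)] -/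
theorem zhuIHv3_of_book_rows_and_node (U : Implications125 ν μ κ c c₂ c₅ c₈ c₂₆ c₅₃ c₅₄ c₆₉ c₁₂₅) (hν : ∀ N, ν.Everything N) (hA3 : c.TaibiInner)
    (hB1 : c.AMR) (hZ : c₆₉.ZhuHyp202) : c₁₂₅.ZhuIHv3 :=
  U.zhuIHv3 hν hA3 hB1 hZ

/-- C36 v3 from the book's inputs along A3 ⇐ book ∧ `StabInner` ∧ B1 and B1 ⇐ book (tranche 1's `taibiInner_of_leaves`, `amr_of_leaves`), with the node granted —
the support of tranche 69's `zhu_of_inputs_and_node`. [cite: Zhu2018FrobeniusHecke, Thm 9.7.5 (arXiv v3) (bookkeeping proved here)] -/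
theorem zhuIHv3_of_inputs_and_node (U : Implications125 ν μ κ c c₂ c₅ c₈ c₂₆ c₅₃ c₅₄ c₆₉ c₁₂₅) (I : Implications ν μ κ c) (A : BookInputs ν)
    (hZ : c₆₉.ZhuHyp202) : c₁₂₅.ZhuIHv3 :=
  zhuIHv3_of_book_rows_and_node U A.everything (taibiInner_of_leaves I A) (amr_of_leaves I A) hZ

/-- ROW C36, THE TWO TEXT STATES SIDE BY SIDE from the book's inputs, tranche 1's edges and the node: the 2018 thesis text's introduction theorem with « Theorem
246 » (tranche 69) and the final revision's Theorems 9.7.5 / 9.8.5 with Corollaries 9.8.8 / 9.8.10 (arXiv v3). [cite: Zhu2018FrobeniusHecke, Thm 246 (2018 text) vs Thms 9.7.5, 9.8.5 (arXiv v3) (bookkeeping proved here)] -/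
theorem c36_two_text_states (Z : Implications69 ν μ κ c c₆₅ c₆₉) (U : Implications125 ν μ κ c c₂ c₅ c₈ c₂₆ c₅₃ c₅₄ c₆₉ c₁₂₅) (I : Implications ν μ κ c)
    (A : BookInputs ν) (hZ : c₆₉.ZhuHyp202) : c₆₉.ZhuOrthogonalIH ∧ c₁₂₅.ZhuIHv3 :=
  ⟨zhu_of_inputs_and_node Z I A hZ, zhuIHv3_of_inputs_and_node U I A hZ⟩

/-- THE WHOLE HUNDRED-AND-TWENTY-FIFTH TRANCHE FROM THE INPUTS OF THE THREE DAGs (KMSW in its proved scope), the edges of tranches 2, 5, 26 and the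
granted rows C168, A8, B24, the Chapter-9 leaf and the node `ZhuHyp202` (tranche 1's edges for A3, B1). [cite: HazeltineLiuLoZhang2025Closure, Thm 1.3 (arXiv v2); MoeglinRenard2020Symetriques, Cor. 4.2 (arXiv v2); JiangZhang2020, Thm 5.1 = Thm B.2; Zhu2018FrobeniusHecke, Thm 9.7.5 (arXiv v3) (bookkeeping proved here)] -/
theorem hundredtwentyfifth_of_inputs (U : Implications125 ν μ κ c c₂ c₅ c₈ c₂₆ c₅₃ c₅₄ c₆₉ c₁₂₅) (I : Implications ν μ κ c) (J : Implications2 ν μ κ c c₂)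
    (V : Implications5 ν μ κ c c₂ c₅) (Y : Implications26 ν μ c c₅ c₁₁ c₂₆) (A : BookInputs ν) (M : MokInputs μ) (K : KMSWInputs μ κ)
    (h₁₆₈ : c₅₄.MoeglinImage) (hA8 : c₂.MoeglinRenard) (h₂₄ : c₅₃.MRunitaryReal) (h9 : c₈.InnerTwists) (hZ : c₆₉.ZhuHyp202) :
    c₁₂₅.HLLZclosureV2 ∧ c₁₂₅.MRsymmetricV2 ∧ c₁₂₅.JZnlio ∧ c₁₂₅.JZnlioU ∧ c₁₂₅.ZhuIHv3 :=
  ⟨hllzClosureV2_of_leaves_and_C168 U J V Y A h₁₆₈, mrSymmetricV2_of_rows U hA8 h₂₄, jzNlio_of_inputs U A M K h9, jzNlioU_of_inputs U M K,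
    zhuIHv3_of_inputs_and_node U I A hZ⟩

/-! ## Hundred-and-twenty-sixth tranche (v2, same unit `pub-arthur-down-g54`): C62 IN arXiv v4 — THEOREM C, ITS HYPOTHESIS 4.5.8, AND THE
HYPOTHESIS' PRINTED SUPPLIER OVER ℚ, ROW C36's COROLLARY 9.8.10 (`PengThmCv4`, `PengKottwitzV4`, `PengHyp458`, `PengHyp458OQ`, `PengKottwitzSOQp`)

Row C62 (H. Peng) was typed in tranche 27 (`Consumers27.PengFS`, `E_PengFS`, `Downstream5.lean`) from the held corpus text: the compatibility
theorem (Fargues–Scholze = semisimplified classical LLC), which is Theorem A of arXiv v4 (2026-07-09, under the new title, 97 pp.; text staged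
by down-g53 as `arxiv-2503.04623v4/` under `HOME/pub-arthur-down-g53/primaries/` and compared by this unit's pass-9 screen).  v4's THEOREM C
(p0004:L21-32: the eigensheaf property of [Far16, 4.4] and the strong Kottwitz statement of [HKW22, 1.0.1] « up to a reparametrization »)
carries a « Moreover, assuming Hypothesis 4.5.8 » clause (= Theorem 7.3.5); HYPOTHESIS 4.5.8 (p0055:L6-41: the Galois representation in the
generic part of the middle-degree ℓ-adic cohomology of orthogonal / unitary Shimura varieties attached to a cohomological cuspidal π with
generic elliptic parameter) is typed as a HYPOTHESIS NODE, of the shape of tranche 79's `Consumers79.LiLiuHypGalois` (v4 itself points to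
« [LL21, Hypothesis 6.6, Remark 6.7] »), with its ONE PRINTED SUPPLIER: p0055:L42 "Remark4.5.9.In Case O, ifF=Q, then Hypothesis 4.5.8 is a corollary of [Zhu24, Corollary 9.8.10]." — [Zhu24] = Astérisque 453 (2024) = row C36's version
of record (bib `Zhu2024AsterisqueFrobeniusHecke`; body not compared), whose « Final revision » arXiv v3 is typed in tranche 125 above,
Corollary 9.8.10 included, as `Consumers125.ZhuIHv3`; the general case is deferred by the text to « a sequel to [KSZ21], assuming the full
endoscopic classification » (no supplier typed; none in print).  Theorem C's own Arthur-side premises are those of `E_PengFS` read at v4's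
places (§2.3 p0022:L23-28; §4.2 Theorem 4.2.1 « Arthur's multiplicity formula », p0043:L59-60 with its proof p0044:L12-16 — generic
elliptic parameters of PURE inner forms over a totally real field: the book, Mok's memoir, KMSW's Theorems 1.6.1 / 1.7.1 inside the PROVED
scope `κ.Scope`, Ishimoto, Chen – Zou, [Pen25] = A12) together with Theorem A itself = `c₂₇.PengFS` (v4's Theorem A, p0003:L22-30, is
the held version's Theorem 1 in the same words — three cases, same conclusion — so no second copy of it is opened).  Edges:
`E_PengThmCv4` ⇐ book ∧ Mok ∧ `κ.Scope` ∧ A5 ∧ `ChenZou` ∧ A12 ∧ C62's Theorem A; `E_PengKottwitzV4` ⇐ Theorem C ∧ the node;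
`E_PengHyp458Instance` (node → its Case O / F = ℚ instance); `E_PengHyp458OQ` ⇐ C36 v3 (exactly what Remark 4.5.9 states);
`E_PengKottwitzSOQp` ⇐ Theorem C ∧ the instance (p0004:L40-42: Theorem C then gives the strong form for special orthogonal groups over
ℚ_p, p > 2, « generalizing [Ham25, Theorem 1.3] »).  No concordance edge old → new; C62's verdict columns are unchanged (the v4 material
is an addition, not a correction); the kernel's headline `pengKottwitzSOQp_of_inputs_and_ZhuNode` shows what « known … by [Zhu24] »
inherits: the book's inputs, Mok's, KMSW's proved scope, and — through C36 — tranche 1's edges for A3 / B1 and C36's own node `ZhuHyp202`. -/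

/-- Row C62 of the census read in arXiv v4 beyond its Theorem A (Theorem C, Theorem 7.3.5, Hypothesis 4.5.8, its Case O / F = ℚ instance, the ℚ_p-corollary), as an arbitrary
assignment of truth values: what the register records is which typed input the TEXT invokes (the `E_…` hypotheses below), never the truth of a field.
[cite: Arthur2013, downstream register of the cell, hundred-and-twenty-sixth tranche (structure only)] -/
structure Consumers126 where
  /-- C62 in arXiv v4: Hao Peng, *Fargues–Scholze correspondence and endoscopic classification for special orthogonal and unitary groups*, arXiv:2503.04623v4 (2026-07-09; PREPRINT; `arxiv-2503.04623v4/` under `HOME/pub-arthur-down-g53/primaries/`; title, dateline, abstract and the sentences naming a conj. are verbatim in the comment lines below), THEOREM C AS PRINTED (p0004:L21-32): p0004:L21-22 "Theorem C.SupposeGis one of the groups appearing inTheorem A,p>2,K/Q pis unramified, andϕ∈Φ(G)is supercuspidal." (1) p0004:L23 "(1) The sheaf" [𝒢_ϕ = ⊕_{b ∈ B(G)_bas} ⊕_{π_b ∈ Π_ϕ(G_b)} i_{b!}(π_b) ∈ D_lis(Bun_G, ℚ̄_ℓ)] admits an action of S_ϕ := Z_Ĝ(ϕ) satisfying conditions (i)–(iv)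 of [Far16, 4.4] p0004:L28 "forG. In particular,G ϕis a Hecke eigensheaf forϕ." (2) the strong Kottwitz statement [HKW22, 1.0.1] holds for G and any conjugacy class of geometric cocharacters {μ} p0004:L30-32 "forGK, up to a reparametrization of elements of theL- packet ofϕthat is independent of the choice of{µ}. Moreover, assumingHypothesis 4.5.8, this reparametrization is trivial."; p0004:L44 "Theorem C is proved in Theorems 7.3.4 and 7.3.7." — Theorem 7.3.4 p0071:L37 "Theorem 7.3.4.For eachI⊂[r] +, there exists a bijection of multisets" […], Theorem 7.3.5 (the « Moreover » clause, field `PengKottwitzV4`), Theorem 7.3.7 p0075:L32-34 "Theorem 7.3.7.Set Gϕ:=⨁ η∈Irr(Sϕ)Actη(π[∅])∈D lis(BunG∗,Qℓ)." […]. [cite: Peng2025FS, Thm C (arXiv v4, p0004:L21-32) = Thms 7.3.4, 7.3.5, 7.3.7 (p0071:L37, p0073:L10, p0075:L32)] -/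
  PengThmCv4 : Prop
  /-- C62 v4, THEOREM C (2)'s « Moreover » clause = THEOREM 7.3.5 (p0073:L10-11, verbatim in the comment lines): if Hypothesis 4.5.8 holds, then the permutation σ_∅ of Theorem 7.3.4 is trivial and the strong Kottwitz statement [HKW22, 1.0.1] holds for the G of Theorem A with the trivial reparametrization; the reduction p0073:L6-7 […] p0073:L6-7 "is equiv- alent to the triviality of the permutationσ ∅." [cite: Peng2025FS, Thm 7.3.5 (arXiv v4, p0073:L10-11)] -/
  PengKottwitzV4 : Prop
  /-- HYPOTHESIS NODE (row C62 v4; no supplier in print beyond the instance below): HYPOTHESIS 4.5.8 AS PRINTED (p0055:L6-41): p0055:L3-5 "To end this section, we recall a hypothesis describing the Galois representation appearing in the generic part of the middle degreeℓ-adic cohomology of orthogonal and unitary Shimura varieties. It will later be used in the proof of the strong Kottwitz" […]; p0055:L6-13 "Hypothesis 4.5.8.Supposeξis the trivial representation of(Res F/QG)⊗ QC, except in Case O2, where its highest weight is (1,...,1) at every infinite place. Supposeπis a cuspidal automorphic representation ofG(A F)that is cohomological forξ, with generic elliptic global parameter ψ= Π 1+···+ Π r, where eachΠ jis a conjugate self-dual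 cuspidal automorphic representation ofGL nj(AF1)for each 1≤j≤r, andn 1+···+n r=N(G). We set" [I ⊂ ℤ the set of infinity-type exponents, its partition I = ∐ I_j by the Π_j, ρ_π^Sh the π-part of the middle-degree cohomology, χ_π, j(π), J(π) as defined there] p0055:L34-39 "j(π), then there is an isomorphism of Galois representations ρπ Sh∼=(⨁ j∈J(π)ρΠj,ℓ)⊕m(π) : GalF1→GLm(π)∑ j∈J(π)nj(Qℓ)." […].  ITS STATUS IN THE TEXT (Remark 4.5.9, p0055:L43-46): p0055:L43-46 "In general, Hypothesis 4.5.8 will be established in a sequel to [KSZ21], assuming the full endoscopic classification for the corresponding unitary and orthogonal groups, cf. [LL21, Hypothesis 6.6, Re- mark 6.7]. Note that the generic part of the endoscopic classification for such groups is established by Chen-Zou [CZ25, Theorem 2.6]." ([LL21, Hypothesis 6.6] is tranche 79's node `Consumers79.LiLiuHypGalois`, unitary groups; [CZ25] = `Consumers.ChenZou`). [cite: Peng2025FS, Hyp. 4.5.8 with Remark 4.5.9 (arXiv v4, p0055:L6-46)] -/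
  PengHyp458 : Prop
  /-- INSTANCE NODE: Hypothesis 4.5.8 in Case O (G special orthogonal, Cases O1 / O2) with F = ℚ — the instance that Remark 4.5.9's first sentence supplies (p0055:L42 "Remark4.5.9.In Case O, ifF=Q, then Hypothesis 4.5.8 is a corollary of [Zhu24, Corollary 9.8.10].") and that §1 uses: p0004:L38-40 "Hypothesis 4.5.8 describes the Galois representation appearing in the generic part of the middle degreeℓ-adic cohomology of orthogonal and unitary Shimura varieties. It is known for orthogonal Shimura varieties overQby [Zhu24, Corollary 9.8.10]. In particular, Theorem C proves the strong" […]. [cite: Peng2025FS, Remark 4.5.9 (arXiv v4, p0055:L42); §1 p0004:L38-40] -/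
  PengHyp458OQ : Prop
  /-- C62 v4, THE COROLLARY THE TEXT DRAWS OVER ℚ_p (p0004:L40-42; the full sentence is in the comment lines): Theorem C gives the strong Kottwitz statement [HKW22, 1.0.1] with the trivial reparametrization p0004:L41-42 "for special orthogonal groups overQ pforp >2, generalizing [Ham25, Theorem 1.3]." — for the special orthogonal groups of Theorem A over ℚ_p, p > 2, Hypothesis 4.5.8 being known in Case O, F = ℚ by [Zhu24, Corollary 9.8.10]. [cite: Peng2025FS, §1 (arXiv v4, p0004:L38-42)] -/
  PengKottwitzSOQp : Prop

-- Verbatim lines of C62 v4 (`arxiv-2503.04623v4/`, under `HOME/pub-arthur-down-g53/primaries/`) kept out of the docstrings by the register's lint (title, sentences naming a conj.,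
--   bibliography): title p0001:L1-2 "FARGUES–SCHOLZE CORRESPONDENCE AND ENDOSCOPIC CLASSIFICATION FOR SPECIAL ORTHOGONAL AND UNITARY GROUPS" / dateline p0001:L44 "arXiv:2503.04623v4  [math.NT]  9 Jul 2026"; abstract p0001:L4-10 "Abstract.Letpbe odd and letK/Q pbe unramified. For a special orthogonal group or a unitary groupGoverKthat splits over an unramified extension, we prove that the Fargues–Scholze local Langlands correspondence agrees with the semisimplification of the classical correspondence for Gconstructed in the work of Arthur and others. As applications, we construct an unambiguous local Langlands correspondence for even special orthogonal groups, deduce the strong Kottwitz conjecture and the eigensheaf conjecture of Fargues, and establish new torsion vanishing results for orthogonal and unitary Shimura varieties."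
--   Theorem C (1), (2): p0004:L27-32 "admits an action ofS ϕ:=ZˆG(ϕ)satisfying conditions (i)–(iv) of Fargues’ conjecture[Far16, Conjecture 4.4]forG. In particular,G ϕis a Hecke eigensheaf forϕ. (2) The strong Kottwitz conjecture[HKW22, Conjecture 1.0.1]holds forGand any conjugacy class of geometric cocharacters{µ}forGK, up to a reparametrization of elements of theL- packet ofϕthat is independent of the choice of{µ}. Moreover, assumingHypothesis 4.5.8, this reparametrization is trivial."
--   §1 on the hypothesis: p0004:L38-43 "Hypothesis 4.5.8 describes the Galois representation appearing in the generic part of the middle degreeℓ-adic cohomology of orthogonal and unitary Shimura varieties. It is known for orthogonal Shimura varieties overQby [Zhu24, Corollary 9.8.10]. In particular, Theorem C proves the strong form of the Kottwitz conjecture for special orthogonal groups overQ pforp >2, generalizing [Ham25, Theorem 1.3]. In general, Hypothesis 4.5.8 will follow from a sequel to [KSZ21] as long as the full endoscopic classification for orthogonal and unitary groups is obtained."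
--   p0055:L5 "It will later be used in the proof of the strong Kottwitz conjecture." / Theorem 7.3.5: p0073:L10-11 "Theorem 7.3.5.IfHypothesis 4.5.8holds, thenσ ∅is trivial, and the strong Kottwitz conjecture holds." / before it: p0073:L6-9 "Theorem 7.3.4 implies that the strong Kottwitz conjecture [HKW22, Conjecture 1.0.1] is equiv- alent to the triviality of the permutationσ ∅. For example, this is known forG= U(V)orGU(V) whereVis an odd-dimensional Hermitian space with respect to the unramified quadratic extension Qp2/Qpby [BMN23]."
--   bibliography: p0097:L39-40 "[Zhu24] Y. Zhu,The stabilization of the Frobenius-Hecke traces on the intersection cohomology of orthogonal Shimura varieties, Astérisque453(2024), ix+292. MR4838820" (= bib `Zhu2024AsterisqueFrobeniusHecke`, row C36's version of record) / p0095:L31-32 "[KSZ21] M. Kisin, S. W. Shin, and Y. Zhu,The stable trace formula for Shimura varieties of abelian type, Preprint (2021), available at arXiv:2110.05381." / p0095:L41-42 "[LL21] C. Li and Y. Liu,Chow groups andL-derivatives of automorphic motives for unitary groups, Ann. of Math. (2)194(2021), no. 3, 817–901. MR4334978"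

variable {c₃ : Consumers3} {c₂₇ : Consumers27}

/-- C62 v4's THEOREM C ⇐ THE PREMISES OF `E_PengFS` AT v4's PLACES ∧ THEOREM A (`arxiv-2503.04623v4/`).  THE LLC AND THE CHARACTER IDENTITIES (§2.3): p0020:L1 "Theorem 2.3.1([Art13,Mok15,KMSW14,CZ21a,CZ21b,Ish24]).If(G=G∗" […]; p0022:L23-28 "We also need certain endoscopic character identities for the local Langlands correspondence. In Case O1, they are established by Arthur [Art13, Theorem 2.2.1] whenGis quasisplit, and by Ishimoto [Ish24, Theorem 3.15] whenGis not quasisplit. In Case U, they are established by Mok [Mok15] whenGis quasisplit, and by Kaletha, Minguez, Shin and White [KMSW14, Theorem 1.6.1] whenGis not quasisplit. In Case O2, they are established by Arthur [Art13, Theorem 2.2.1] whenGis quasisplit, and are established by [Pen25, Theorem A] whenGis not quasisplit." ([Pen25] = row A12, `c₄.Peng`; [Ish24] = A5 `IshimotoGeneric`; the Chen – Zou items as in `E_PengFS`).  THE GLOBALISATION (§§4.2–4.5, 5.2, 7.3; Theorem 7.3.5's proof: p0073:L17 "Following §5.2, we globalizeK 1/KtoF 1/FandG∗/KtoG/F,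 and retain the notation from" […]; p0075:L17-18 "However, it follows from Arthur’s multiplicity formula thatσ ∅(j)is contained in J(Πj), and it follows from Hypothesis 4.5.8 thatjis contained inJ(Π j)."): p0042:L17-20 "4.2.Endoscopic classification of automorphic representations.LetG∗be as in §4.1 and (G,ϱ,z)be a pure inner form ofG∗. To prepare for the Langlands–Kottwitz method in §4.5, we recall some results on endoscopic classifications of automorphic representations of orthogonal and unitary groups over a totally real field, following [Art13,KMSW14,Ish24,CZ25]." — PURE inner forms, and p0043:L59-60 "We then have the following theorem, usually called “Arthur’s multiplicity formula”: Theorem 4.2.1([Art13,Mok15,KMSW14,Ish24,CZ25]).Ifψis an elliptic globalA-parameter for" […] with p0044:L1 "Furthermore, for each generic elliptic globalA-parameterψ= Π 1+···+ Π kforG, there exists" […]; its proof p0044:L12-16 "Proof.In Case O1, this is established in [Art13] whenGis quasisplit, and established in [Ish24, Theorem 3.16, 3.17] whenGis non-quasisplit. In Case O2, this is established in [Art13] when Gis quasisplit, and in [CZ25, Theorem 2.1, 2.6] whenGis non-quasisplit. In Case U, this is established in [Mok15] whenGis quasisplit and established in [KMSW14, Theorem 1.7.1] whenG is non-quasisplit.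 □" — for GENERIC elliptic parameters of pure inner forms these are KMSW's Theorems 1.6.1 / 1.7.1 inside the PROVED scope (`κ.Scope` = `T161g ∧ LIRg ∧ T171p`), Ishimoto's and Chen – Zou's generic theorems (`c.IshimotoGeneric`, `c.ChenZou`), as in `E_PengFS`.  THEOREM A = `c₂₇.PengFS`: p0003:L22-30 "Theorem A.Supposep>2andK/Q pis unramified. (1) IfG= U(V)whereVis a Hermitian space with respect to the unramified quadratic extension K1/K, then the diagram(1.1)is commutative. (2) IfG= SO(V)whereVis a quadratic space overKwithdim(V) = 2n+ 1for some positive integern, then the diagram(1.1)is commutative. (3) IfG= SO(V)whereVis a quadratic space overKof dimension2nfor some positive integernsuch thatGsplits over an unramified quadratic extension ofK(equivalently, ordK(disc(V))≡0(mod 2); see§2.1), then the diagram(1.1)is commutative up to conju- gation byO(2n,C)." (the held version's Theorem 1 in the same words, tranche 27).  Published Arthur-free inputs absorbed (per the text): Fargues – Scholze [FS24], Hansen – Kaletha – Weinstein [HKW22], X. Shen [She20], Kisin – Shin – Zhu [KSZ21], the Act-functor formalism of [MHN24, §4.1.3] (row C63's method: p0075:L30-31 "Following [MHN24, §4.1.3],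 we construct eigensheaves attached to the supercuspidalL- parametersϕ:"). [cite: Peng2025FS, Thm C (arXiv v4): §2.3 p0020:L1, p0022:L23-28; §4.2 p0042:L17-20, p0043:L59-60, p0044:L1, L12-16; §7.3 p0073:L17, p0075:L17-18] [claim: KalethaMinguezShinWhite2014, under-review] -/
def E_PengThmCv4 (ν : Nodes) (μ : Mok2015.Nodes) (κ : KMSW2014.Nodes) (c : Consumers) (c₄ : Consumers4) (c₂₇ : Consumers27) (c₁₂₆ : Consumers126) : Prop :=
  (∀ N, ν.Everything N) → (∀ N, μ.Everything N) → (∀ N, κ.Scope N) → c.IshimotoGeneric → c.ChenZou → c₄.Peng → c₂₇.PengFS →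
    c₁₂₆.PengThmCv4

/-- C62 v4's THEOREM 7.3.5 ⇐ THEOREM C ∧ THE HYPOTHESIS NODE (`arxiv-2503.04623v4/`): statement p0073:L10-11 (comment lines); proof p0073:L12-13 "Proof.FixI⊂[r] +with#I≡1(mod 2). By Theorem 7.3.4, there is an isomorphism ofG∗(K)× WK1-modules" […] p0073:L17 "Following §5.2, we globalizeK 1/KtoF 1/FandG∗/KtoG/F, and retain the notation from" […] p0075:L17-18 "However, it follows from Arthur’s multiplicity formula thatσ ∅(j)is contained in J(Πj), and it follows from Hypothesis 4.5.8 thatjis contained inJ(Π j)." [cite: Peng2025FS, Thm 7.3.5 (arXiv v4, p0073:L10-23, p0075:L17-18)] -/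
def E_PengKottwitzV4 (c₁₂₆ : Consumers126) : Prop := c₁₂₆.PengThmCv4 → c₁₂₆.PengHyp458 → c₁₂₆.PengKottwitzV4

/-- THE NODE'S INSTANCE: Hypothesis 4.5.8 (Cases O1 / O2 / U, any totally real F) specialised to Case O with F = ℚ — the instance Remark 4.5.9 addresses. [cite: Peng2025FS, Hyp. 4.5.8 (arXiv v4, p0055:L6-41) ⊇ its Case O / F = ℚ instance, Remark 4.5.9 (p0055:L42) (bookkeeping edge)] -/
def E_PengHyp458Instance (c₁₂₆ : Consumers126) : Prop := c₁₂₆.PengHyp458 → c₁₂₆.PengHyp458OQ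

/-- SUPPLY EDGE FOR THE INSTANCE, EXACTLY AS REMARK 4.5.9 STATES IT (`arxiv-2503.04623v4/` p0055:L42 "Remark4.5.9.In Case O, ifF=Q, then Hypothesis 4.5.8 is a corollary of [Zhu24, Corollary 9.8.10].") ⇐ ROW C36: [Zhu24] (bibliography p0097:L39-40, comment lines) = Astérisque 453 (2024) = the version of record of arXiv:1801.09404 (bib `Zhu2024AsterisqueFrobeniusHecke`; body not compared with arXiv v3), whose « Final revision » arXiv v3 is typed in tranche 125 above with Corollary 9.8.10 (`arxiv-1801.09404v3/` under `HOME/pub-arthur-down-g52/primaries/`, p0295:L50 – p0296:L24) among the conjuncts of `Consumers125.ZhuIHv3`.  The step Cor. 9.8.10 ⇒ Hyp. 4.5.8 (Case O, F = ℚ) is the author's remark and is not re-derived here. [cite: Peng2025FS, Remark 4.5.9 (arXiv v4, p0055:L42); Zhu2018FrobeniusHecke, Cor. 9.8.10 (arXiv v3, p0295:L50 – p0296:L24); Zhu2024AsterisqueFrobeniusHecke] -/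
def E_PengHyp458OQ (c₁₂₅ : Consumers125) (c₁₂₆ : Consumers126) : Prop := c₁₂₅.ZhuIHv3 → c₁₂₆.PengHyp458OQ

/-- C62 v4's COROLLARY OVER ℚ_p ⇐ THEOREM C ∧ THE INSTANCE (`arxiv-2503.04623v4/` p0004:L38-42, comment lines and the fields' quotations): Theorem 7.3.5's proof globalises K₁/K to F₁/F (p0073:L17 "Following §5.2, we globalizeK 1/KtoF 1/FandG∗/KtoG/F, and retain the notation from" […]) and uses Hypothesis 4.5.8 for that (G, F) (p0075:L17-18); for K = ℚ_p, p > 2, and G special orthogonal the text takes F = ℚ and the instance known by [Zhu24]. [cite: Peng2025FS, §1 (arXiv v4, p0004:L38-42); Thm 7.3.5 (p0073:L10-23)] -/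
def E_PengKottwitzSOQp (c₁₂₆ : Consumers126) : Prop := c₁₂₆.PengThmCv4 → c₁₂₆.PengHyp458OQ → c₁₂₆.PengKottwitzSOQp

/-- The hundred-and-twenty-sixth tranche of implications. [cite: Peng2025FS, Thm C, Thm 7.3.5, Hyp. 4.5.8 with Remark 4.5.9, §1 p0004:L38-42 (arXiv v4); Zhu2018FrobeniusHecke, Cor. 9.8.10
(arXiv v3) (each edge's source in its own docstring)] -/
structure Implications126 (ν : Nodes) (μ : Mok2015.Nodes) (κ : KMSW2014.Nodes) (c : Consumers) (c₄ : Consumers4) (c₂₇ : Consumers27)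
    (c₁₂₅ : Consumers125) (c₁₂₆ : Consumers126) : Prop where
  pengThmCv4 : E_PengThmCv4 ν μ κ c c₄ c₂₇ c₁₂₆
  pengKottwitzV4 : E_PengKottwitzV4 c₁₂₆
  pengHyp458Instance : E_PengHyp458Instance c₁₂₆
  pengHyp458OQ : E_PengHyp458OQ c₁₂₅ c₁₂₆
  pengKottwitzSOQp : E_PengKottwitzSOQp c₁₂₆

variable {c₁₂₆ : Consumers126}

/-- C62 v4's Theorem C given the three monographs' outputs (KMSW in its proved scope), the rows A5 (generic), `ChenZou`, A12 and C62's Theorem A.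
[cite: Peng2025FS, Thm C (arXiv v4) (bookkeeping proved here)] [claim: KalethaMinguezShinWhite2014, under-review] -/
theorem pengThmCv4_of_inputs_and_rows (P : Implications126 ν μ κ c c₄ c₂₇ c₁₂₅ c₁₂₆) (hν : ∀ N, ν.Everything N) (hμ : ∀ N, μ.Everything N)
    (hκ : ∀ N, κ.Scope N) (h₅ : c.IshimotoGeneric) (h₆ : c.ChenZou) (h₁₂ : c₄.Peng) (h₆₂ : c₂₇.PengFS) : c₁₂₆.PengThmCv4 :=
  P.pengThmCv4 hν hμ hκ h₅ h₆ h₁₂ h₆₂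

/-- C62 v4's Theorem C from the leaves: every input of the book, of Mok's memoir and of KMSW's proved scope — through tranche 27's `pengFS_of_leaves`
(Theorem A) and the edges for A5 (book ∧ `StabInner`), `ChenZou` (book ∧ Mok), A12 (book ∧ `ChenZou` ∧ `StabInner`) — and NO KMSW sequel.
[cite: Peng2025FS, Thm C (arXiv v4) (bookkeeping proved here)] [claim: KalethaMinguezShinWhite2014, under-review] -/
theorem pengThmCv4_of_leaves (P : Implications126 ν μ κ c c₄ c₂₇ c₁₂₅ c₁₂₆) (Z : Implications27 ν μ κ c c₄ c₂₇) (I : Implications ν μ κ c)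
    (W : Implications4 ν μ κ c c₂ c₃ c₄) (A : BookInputs ν) (M : MokInputs μ) (K : KMSWInputs μ κ) : c₁₂₆.PengThmCv4 :=
  pengThmCv4_of_inputs_and_rows P A.everything M.everything (K.scope M) (ishimotoGeneric_of_leaves I A) (chenZou_of_leaves I A M)
    (peng_of_leaves I W A M) (pengFS_of_leaves Z I W A M K)

/-- THEOREM 7.3.5 = THEOREM C (2) WITH THE TRIVIAL REPARAMETRIZATION, from the leaves: conditional on exactly the hypothesis node.
[cite: Peng2025FS, Thm 7.3.5 (arXiv v4) (bookkeeping proved here)] [claim: KalethaMinguezShinWhite2014, under-review] -/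
theorem pengKottwitzV4_of_leaves_and_node (P : Implications126 ν μ κ c c₄ c₂₇ c₁₂₅ c₁₂₆) (Z : Implications27 ν μ κ c c₄ c₂₇) (I : Implications ν μ κ c)
    (W : Implications4 ν μ κ c c₂ c₃ c₄) (A : BookInputs ν) (M : MokInputs μ) (K : KMSWInputs μ κ) : c₁₂₆.PengHyp458 → c₁₂₆.PengKottwitzV4 :=
  fun hH => P.pengKottwitzV4 (pengThmCv4_of_leaves P Z I W A M K) hH

/-- The instance from the node (a specialisation). [cite: Peng2025FS, Hyp. 4.5.8 ⊇ its Case O / F = ℚ instance (arXiv v4) (bookkeeping proved here)] -/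
theorem pengHyp458OQ_of_node (P : Implications126 ν μ κ c c₄ c₂₇ c₁₂₅ c₁₂₆) (hH : c₁₂₆.PengHyp458) : c₁₂₆.PengHyp458OQ :=
  P.pengHyp458Instance hH

/-- The instance from row C36 v3, Remark 4.5.9's supplier. [cite: Peng2025FS, Remark 4.5.9 (arXiv v4); Zhu2018FrobeniusHecke, Cor. 9.8.10 (arXiv v3) (bookkeeping proved here)] -/
theorem pengHyp458OQ_of_C36 (P : Implications126 ν μ κ c c₄ c₂₇ c₁₂₅ c₁₂₆) (h₃₆ : c₁₂₅.ZhuIHv3) : c₁₂₆.PengHyp458OQ :=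
  P.pengHyp458OQ h₃₆

/-- The instance from the book's inputs, tranche 1's edges for A3 / B1 and C36's own node `ZhuHyp202`, through tranche 125's `zhuIHv3_of_inputs_and_node`:
« known for orthogonal Shimura varieties over Q by [Zhu24] » inherits C36's hypothesis node. [cite: Peng2025FS, Remark 4.5.9 (arXiv v4); Zhu2018FrobeniusHecke,
Cor. 9.8.10 with Hyp. 9.1.2 (arXiv v3) (bookkeeping proved here)] -/
theorem pengHyp458OQ_of_inputs_and_ZhuNode (P : Implications126 ν μ κ c c₄ c₂₇ c₁₂₅ c₁₂₆) (U : Implications125 ν μ κ c c₂ c₅ c₈ c₂₆ c₅₃ c₅₄ c₆₉ c₁₂₅)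
    (I : Implications ν μ κ c) (A : BookInputs ν) (hZ : c₆₉.ZhuHyp202) : c₁₂₆.PengHyp458OQ :=
  P.pengHyp458OQ (zhuIHv3_of_inputs_and_node U I A hZ)

/-- THE HEADLINE OF THE TRANCHE: the strong Kottwitz statement with the trivial reparametrization for the special orthogonal groups of Theorem A over
ℚ_p (p > 2), from the inputs of the three DAGs (KMSW in its proved scope), the rows of `E_PengFS`, C62's Theorem A and — through C36 — tranche 1's
edges and the node `ZhuHyp202`; no KMSW sequel and no appeal to the general node `PengHyp458`. [cite: Peng2025FS, §1 p0004:L38-42 with Thm 7.3.5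
(arXiv v4) (bookkeeping proved here)] [claim: KalethaMinguezShinWhite2014, under-review] -/
theorem pengKottwitzSOQp_of_inputs_and_ZhuNode (P : Implications126 ν μ κ c c₄ c₂₇ c₁₂₅ c₁₂₆) (U : Implications125 ν μ κ c c₂ c₅ c₈ c₂₆ c₅₃ c₅₄ c₆₉ c₁₂₅)
    (Z : Implications27 ν μ κ c c₄ c₂₇) (I : Implications ν μ κ c) (W : Implications4 ν μ κ c c₂ c₃ c₄) (A : BookInputs ν) (M : MokInputs μ)
    (K : KMSWInputs μ κ) (hZ : c₆₉.ZhuHyp202) : c₁₂₆.PengKottwitzSOQp :=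
  P.pengKottwitzSOQp (pengThmCv4_of_leaves P Z I W A M K) (pengHyp458OQ_of_inputs_and_ZhuNode P U I A hZ)

/-- THE HEADLINE IN CONDITIONAL FORM, 2026: granting the book's, Mok's and KMSW's internal derivations, supply edges and every PUBLISHED input, KMSW's
import of Mok and the identification of the two copies of the general weighted FL, the rows' edges and C36's node, the ℚ_p-corollary is conditional
on the two 2024–2026 preprint layers and on the general and the non-standard weighted fundamental lemmas (the book's copies and Mok's copies); nothing
of KMSW's unwritten sequels, nothing of `PengHyp458`. [cite: Peng2025FS, §1 p0004:L38-42 (arXiv v4) (bookkeeping proved here)] [claim: KalethaMinguezShinWhite2014, under-review] -/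
theorem pengKottwitzSOQp_conditional_form (P : Implications126 ν μ κ c c₄ c₂₇ c₁₂₅ c₁₂₆) (U : Implications125 ν μ κ c c₂ c₅ c₈ c₂₆ c₅₃ c₅₄ c₆₉ c₁₂₅)
    (Z : Implications27 ν μ κ c c₄ c₂₇) (I : Implications ν μ κ c) (W : Implications4 ν μ κ c c₂ c₃ c₄) (D1 : KMSW2014.E_ImportMok μ κ)
    (D3 : KMSW2014.E_SameWFL μ κ) (B : ν.BookEdges) (S : ν.SupplyEdges) (PL : ν.PublishedLeaves) (MB : μ.SectionEdges) (MS : μ.SupplyEdges)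
    (MP : μ.PublishedLeaves) (KB : κ.ChapterEdges) (KS : κ.SupplyEdges) (KP : κ.PublishedLeaves) (hZ : c₆₉.ZhuHyp202) :
    ν.PreprintLeaves2026 → μ.PreprintLeaves2026 → ν.WFL_general → ν.WFL_nonstandard → μ.WFL_general → μ.WFL_nonstandard → c₁₂₆.PengKottwitzSOQp :=
  fun hQ hMQ h6 h7 m6 m7 =>
    pengKottwitzSOQp_of_inputs_and_ZhuNode P U Z I W ⟨B, S, PL, hQ, ⟨h6, h7⟩⟩ ⟨MB, MS, MP, hMQ, ⟨m6, m7⟩⟩ ⟨D1, KB, KS, KP, ⟨D3 m6⟩⟩ hZ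

/-- ROW C62, THE TWO TEXT STATES SIDE BY SIDE from the same inputs: Theorem A (= the held version's Theorem 1, tranche 27) and v4's Theorem C.
[cite: Peng2025FS, Thm 1 (held version) = Thm A and Thm C (arXiv v4) (bookkeeping proved here)] [claim: KalethaMinguezShinWhite2014, under-review] -/
theorem c62_two_text_states (Z : Implications27 ν μ κ c c₄ c₂₇) (P : Implications126 ν μ κ c c₄ c₂₇ c₁₂₅ c₁₂₆) (I : Implications ν μ κ c)
    (W : Implications4 ν μ κ c c₂ c₃ c₄) (A : BookInputs ν) (M : MokInputs μ) (K : KMSWInputs μ κ) : c₂₇.PengFS ∧ c₁₂₆.PengThmCv4 :=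
  ⟨pengFS_of_leaves Z I W A M K, pengThmCv4_of_leaves P Z I W A M K⟩

/-- THE WHOLE HUNDRED-AND-TWENTY-SIXTH TRANCHE FROM THE INPUTS OF THE THREE DAGs (KMSW in its proved scope), tranche 27's and tranche 4's edges, tranche
125's edge for C36 v3 with tranche 1's edges and the node `ZhuHyp202`: Theorem C, the instance of Hypothesis 4.5.8 over ℚ, the ℚ_p-corollary, and
Theorem 7.3.5 conditional on the general node. [cite: Peng2025FS, Thm C, Thm 7.3.5, Remark 4.5.9 (arXiv v4) (bookkeeping proved here)] [claim: KalethaMinguezShinWhite2014, under-review] -/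
theorem hundredtwentysixth_of_inputs (P : Implications126 ν μ κ c c₄ c₂₇ c₁₂₅ c₁₂₆) (U : Implications125 ν μ κ c c₂ c₅ c₈ c₂₆ c₅₃ c₅₄ c₆₉ c₁₂₅)
    (Z : Implications27 ν μ κ c c₄ c₂₇) (I : Implications ν μ κ c) (W : Implications4 ν μ κ c c₂ c₃ c₄) (A : BookInputs ν) (M : MokInputs μ)
    (K : KMSWInputs μ κ) (hZ : c₆₉.ZhuHyp202) :
    c₁₂₆.PengThmCv4 ∧ c₁₂₆.PengHyp458OQ ∧ c₁₂₆.PengKottwitzSOQp ∧ (c₁₂₆.PengHyp458 → c₁₂₆.PengKottwitzV4) :=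
  ⟨pengThmCv4_of_leaves P Z I W A M K, pengHyp458OQ_of_inputs_and_ZhuNode P U I A hZ, pengKottwitzSOQp_of_inputs_and_ZhuNode P U Z I W A M K hZ,
    pengKottwitzV4_of_leaves_and_node P Z I W A M K⟩

/-! ## Hundred-and-twenty-seventh tranche (v3, unit `pub-arthur-down-g55`, downstream tracer gen 55): THE LATEST arXiv TEXT STATES VII — THE
SENTENCE-LEVEL STATUS-DRIFT SCREEN: row C270 in arXiv v2 (`HYthetaV2gen`, `HYthetaV2`, node `HYmultOneD`), row C82 in arXiv v5 (`WeissImagesV5`, node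
`WeissLiftGL4`); the later STATUS WORDING of rows C220 (arXiv v2) and C80 (arXiv v5), which changes no typed statement or edge, recorded in this docstring

WHY.  Down-g52's pass 8 read the register's typed QUOTATIONS against the latest arXiv version of every row; down-g54's pass 9 counted upstream-relevant
NEEDLES in the corpus text versus the latest text.  This unit's pass 10 (`HOME/pub-arthur-down-g55/work/pass10/pass10.py`, report `pass10_report.txt`,
by-eye residue `pass10_residue.txt`) works at the level in between: for each of the 201 register ids whose latest arXiv version is later than v1 (texts
staged by down-g53 under `HOME/pub-arthur-down-g53/primaries/arxiv-<id>vN/`), the CORPUS text the register quotes (`lit read paper:arxiv-<id>`) and the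
LATEST text are split into sentences, the STATUS-BEARING sentences (a status word and an upstream name) are kept, and every such sentence of one text with no
close counterpart in the other (word-set Jaccard < 0.55 and containment < 0.75) is listed as NEW / REWRITTEN or DROPPED with its `pNNNN:L` locator; the 27 ids
without a corpus text were screened against the earlier units' staged copies instead (`pass10b_report.txt`: all clean).  355 residue sentences over 88 ids were
read by eye; most are renderer artefacts (TeX source versus PDF text) or states earlier tranches already typed (A6 v3, C197 v2, C28 v2, B28 v2, C62 v4, C36 v3,
B31 v2, B44 v2, B12 v3, B48 v2, C35 v7, B100 v4, C207 v2, C205 v2, C66).  FOUR are new to the register.  Two change the TYPED STATEMENT and are typed below;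
two change only the authors' STATUS WORDING and are recorded here (no field, no edge — the convention of tranche 120).

(1) ROW C270, Ming-Lun Hsieh – Shunsuke Yamana, *Bessel periods and anticyclotomic p-adic spinor L-functions* (bib `HsiehYamana2024BesselPeriods`: Trans.
Amer. Math. Soc. (2024), doi:10.1090/tran/9143; version of record not compared).  Tranche 105 (`Consumers105.HYjl`, `HYboch`, `HYtheta`, `E_HYtheta`,
`Downstream31.lean`) typed the corpus TeX `paper-arxiv-1810.03231`, whose docstring dates it « arXiv v2 2022-07-06 »; the corpus text is in fact the 2018
CONTENT (its main theorem is « Theorem 1.2 » under the hypotheses (Heeg), (JL), (Böch), (𝒬), with the sentence « Arthur's project will establish this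
hypothesis » after (JL) and no reference to Rösner – Weissauer) — an erratum of DATING, not of quotation.  The arXiv v2 PDF of 2022-07-06 (`arxiv-1810.03231v2/`,
60 pp.) RESTATES the paper: the main theorems are THEOREM 1.4 (N square-free, K split at the primes of N, π tempered, (Q-ord)) and THEOREM 2.5 ((Heeg),
(Q-ord); π tempered by the standing hypothesis of §2.4), and the two former hypothesis nodes are DISCHARGED IN PRINT: (Böch) is now Furusawa – Morimoto's
theorem, cited as « [15, Theorem 1.2] » = arXiv:2205.09503 = row C226's Theorem 1.2 (`Consumers89.FMrefined`, tranche 89, `Downstream25.lean`; Compositio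
Math. 160 (2024)), restated as the text's Theorem 1.2 / Theorem 9.1; (JL) is taken, for N⁻ ≠ 1, from « the inner form transfer on PGSp4 established in [39,
Theorem 11.4] » = Rösner – Weissauer, arXiv:2103.14715 = J. Number Theory 263 (2024) = the census's CONTROL row C18 / E4 (an Arthur-independent proof for the
cohomological spectrum of the inner forms of GSp(4); no typed field; a published Arthur-free input, absorbed).  What remains of Arthur in v2 is §9.1's by-name
use, p0047:L5-10 "Letπ≃ ⊗′ vπvbe an irreducible admissible representation of PGUD 2(AF) whichisrealizedonasubspace VofAcusp(PGUD 2). Thespace Acusp(PGSp4) satisﬁes multiplicity one thanks to the work of Arthur." (`arxiv-1810.03231v2/`) ↦ `∀ N, ν.Everything N` (the register's by-name convention, as in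
tranche 105), followed (p0047:L10-12, comment lines below) by the sentence that the multiplicity one of 𝒜_cusp(PGU^D_2) is conj.d in general and ASSUMED —
the one hypothesis node of the v2 text, `HYmultOneD` (void when N⁻ = 1: D is then split and PGU^D_2 = PGSp4, whose multiplicity one the text takes from
Arthur).  Typed: `HYthetaV2gen` (Theorem 2.5) ⇐ book ∧ C226's Theorem 1.2 ∧ the node; `HYthetaV2` (Theorem 1.4 = « its special case where N = N⁺ and N⁻ =
1 ») ⇐ book ∧ C226's Theorem 1.2, and ⇐ Theorem 2.5 (bookkeeping edge); the side-by-side theorem `c270_two_text_states` derives the 2018 statement from the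
book's inputs AND ITS TWO NODES and the 2022 statement from the book's inputs, Mok's and KMSW's proved scope (through C226 ⇐ C67 ∧ C24) and NO node.

(2) ROW C82, Ariel Weiss, *On the images of Galois representations attached to low weight Siegel modular forms* (bib `WeissAriel2022Images`: J. Lond. Math.
Soc. (2) 106 (2022) 358–387; version of record not compared).  Tranche 29 (`Consumers29.WeissImages`, `E_WeissImages` ⇐ book ∧ A4 ∧ C191, `Downstream6.lean`)
typed Theorems A / B of the 2018 corpus TeX (« not CAP or endoscopic »; §0.2 « Dependence on Arthur's classification » naming the twisted weighted fundamental
lemma and « unpublished work of Arthur »).  arXiv v5 of 2021-12-09 (`arxiv-1802.08537v5/`, 25 pp.) RESTATES Theorems 1.1 / 1.2 with the HYPOTHESIS « Assume that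
the weak functorial lift of π to GL4 exists and is cuspidal » (and 1.1 (i) as « de Rham and ℓ ≥ 5 » for « crystalline and ℓ > 2k−1 »), moves the Arthur input
INTO that hypothesis — p0001:L29-34 "In general, the existence of this lift follows from Arthur’s cl assiﬁcation [ Art13 ]; see Section 2.4for further discussion."; §2.4 p0005:L50-52 "More generally, the existence of a lift to GL4follows from Arthur’s endoscopic classiﬁcation [Art13 ]. Indeed, the case of PGSp4, i.e. where πhas trivial central character, has been spelled out in detail in [ Art04 ], and this work has been generalised by Gee–Taïbi [ GT19 ] to cover all" p0006:L1-3 "automorphic representations of GSp4. However, these works are all dependent on several papers that have been announced, but have yet to appear: see the disc ussions in [ GT19 , pp. 3] and in [Mok14 , pp. 527]." —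
states that for cohomological π the lift is Weissauer's and Asgari – Shahidi's, p0005:L48-49 "In particular, the results of this paper apply unconditionally to cohomological Siegel modular forms.", and says of Mok's eigenvariety
construction (row C191), which the 2018 text called dependent on « unpublished work of Arthur », p0008:L13-15 "However, the construction only requires the existence of a functorial lift from GSp4toGL4for cohomological forms, so the construction is still unconditional for automorphic repre sentations of GSp4(AQ).".  Typed:
the node `WeissLiftGL4` ⇐ book ∧ A4 (exactly the supplier the text names, with its flag); `WeissImagesV5` ⇐ C191 ∧ the node (Mok's Theorem 3.5 is used for
local-global compatibility in both weight ranges, p0007:L16-17, p0008:L15-17; the register records the USE of row C191 and leaves C191's own edge ⇐ book ∧ A4 as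
tranche 28 typed it from Mok's text — the v5 sentence that the construction is unconditional over ℚ is the author's, recorded, not adjudicated); the
side-by-side theorem `c82_two_text_states` derives both statements from the book's inputs (the same 24-leaf support either way: through A4 and C191).

(3) STATUS WORDING ONLY (typed statement and edge unchanged; census wording / docstring-touch items).  (a) ROW C220, S. W. Shin – N. Templier, Compositio Math.
150 (2014) (bib `ShinTemplier2014Fields`; tranche 90, `Consumers87.STfiniteness` / `STgrowth` ⇐ book ∧ Mok, `Downstream24.lean`, typed the corpus TeX and dated
it « arXiv v2 of 2014-07-02 » — the corpus text is the v1 CONTENT of 2013: « his forthcoming book », « Also assume the hypotheses as explained in [BMM] (on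
which [Arthur] and [Mok] are conditional) » inside Hypothesis (hypo:TwTF), bibliography « [Arthur] … Preprint, http://www.claymath.org/cw/arthur/ »; an
erratum of dating).  The arXiv v2 PDF (`arxiv-1302.6144v2/`, 2014-07-02, « At the time of revision ») words §1.4 as p0003:L13-19 "1.4.Main results. Let us make it clear at the outset that our results concerning quas i-split classical (i.e. symplectic, orthogonal1, or unitary) groups rely on Arthur’s endoscopic classiﬁcation [2] an d its analogue for unitary groups due to Mok [42]. (However our ﬁnitenes s theorem for general linear groups, cf. Theorem 1.6 below, is unconditional.) The classiﬁcation is based on s ome unproven assertions on the stabilization of the twisted trace formula for GLnand a little more, which are hoped to be proved in the near future. So we are making the same hypotheses as Arthur doe s in his work. (Also see [4, 1.18] and the footnote around Hypothesis 4.8 for a discussion of the hypoth eses.)",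
states HYPOTHESIS 4.8 WITHOUT the [BMM] clause, p0022:L17-20 "To use results for automorphic representations on quasi-split clas sical groups as in [2] (symplectic and orthogonal) and [42] (unitary), we assume10 Hypothesis 4.8.Suppose that the twisted trace formula for GLnand twisted even orthogonal groups can be stabilized in the sense of [2, Hypo 3.2.1] and [42, Hypo 4.2.1].", and attaches FOOTNOTE 10, p0022:L58-66 "10One can be optimistic that the hypothesis will become unnece ssary before long. At the time of revision, Waldspurger has released a series of ﬁve preprints (more to come) on the st abilization of the general twisted trace formula. For an ext ra careful reader, we remark that both [2] and [42] depend on the papers [A25] and [A26] of [2], which have not appeared up to now, and that the proof of the weighted fundamental lemma has not been completely written up, cf. footnote in Appendix A of [4]. Proposition 8.2.5 of [42] asserts that Ban’s result , cited as [Ban] there and proved only for split groups, exten ds to quasi-split unitary groups but this appears to be a nontrivi al point to be justiﬁed. Arthur, as well as Mok, refers to work in progress by Mezo and Shelstad on twisted endoscopy for real g roups and by Waldspurger on the local twisted trace formula. This seems ﬁne: The former is basically addressed in the prep rints cited as [Me] and [S8] in [2]; they have been updated or expanded since Arthur’s book was published. The latter appe ared in the preprint “La formule des traces locales tordue”." —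 with [2] = p0036:L39-40 "[2] J. Arthur. The endoscopic classiﬁcation of representations , volume 61 of American Mathematical Society Colloquium Publications . American Mathematical Society, Providence, RI, 2013. Ort hogonal and symplectic groups.",
[42] = p0037:L55-56 "[42] C. P. Mok. Endoscopic classiﬁcation of representation s of quasi-split unitary groups. to appear in Mem. Amer. Math. Soc.,", [4] = p0036:L43-44 "[4] N. Bergeron, J. Millson, and C. Moeglin. Hodge type theor ems for arithmetic manifolds associated to orthogonal groups.preprint, arXiv:1110.3049 ." (= rows C17 / D3 / D4's source).  For the census: C220's conditionality wording in its revised text is the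
most itemised flag of the 2014 literature in this register — it NAMES [A25] and [A26] (the book's unwritten references; leaves of the cell's `DependencyDag`),
the weighted fundamental lemma's write-up (cf. the cell's leaves `WFL_general` / `WFL_nonstandard`), Mok's Proposition 8.2.5 / [Ban] for non-split quasi-split
unitary groups (the point KMSW's Appendix A and AGIKMS's Appendix B later address — the cell's Mok DAG edge `E_P825`), Mezo – Shelstad and Waldspurger's local
twisted trace formula; Theorem 5.19 itself is verbatim in v2 up to renumbering (down-g53, D-DN-g53-12; its text names a conj. and is in the comment lines of
tranche 90).  (b) ROW C80, E. Eischen – M. Harris – J.-S. Li – C. Skinner, Forum Math. Pi 8 (2020) (bib `EischenHarrisLiSkinner2020`; tranche 71, `Downstream19.lean`: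
node `Consumers71.EHLSMultOne` = their Global Multiplicity One Hypothesis, `EHLSpadicL` = Main Theorem ⇐ the node; the corpus TeX typed there says of the
hypothesis « established by Mok » when G is quasi-split and « being treated by Kaletha, Mínguez, Shin, and White » in general, with NO sentence on Arthur).  arXiv
v5 of 2020-03-06 = the journal-formatted text (`arxiv-1602.01776v5/`, p0001:L1-3 "arXiv:1602.01776v5  [math.NT]  6 Mar 2020Forum of Mathematics, Pi (2020), vol. , e1, 152 pages doi:1 p-ADIC L-FUNCTIONS FOR UNITARY GROUPS") says instead, p0100:L2-10 "This multiplicity one hypothesis for πis expected to hold if S=S(Kp) consists only of places that are split in K/K+(so all local L-packets are singletons) and if the base change of πto GL n/Kis cuspidal (so πis not obtained by endoscopic transfer from a non-trivial elliptic endosco pic group of G). When Gis quasi-split multiplicity one has been established for th eunitary group by Mok [ Mok15 ], and the general case has been proved under certain restric tive hypotheses by Kaletha, M´ ınguez, Shin, and White [ KMSW14 ]. All this work is based in part on results that have been announced by Arthur bu t that have not yet appeared." — an EXPLICIT FLAG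
(« announced by Arthur but … not yet appeared ») absent from the text the register graded, and KMSW's theorem as « proved under certain restrictive
hypotheses »; the node and the edge stand as typed (the hypothesis is still assumed, p0100:L11 "We will generally assume that πsatisﬁes this multiplicity one hypothesis.").  Both (a) and (b) are docstring-touch items for
`Downstream24.lean` / `Downstream19.lean` once the olean store allows the early files to be re-emitted, and census-wording lines now (`DOWNSTREAM5.md` Block B¹³⁶). -/

/-- Rows C270 (arXiv v2) and C82 (arXiv v5) of the census read in their latest arXiv texts, as an arbitrary assignment of truth values: what the register records is which
typed input the TEXT invokes (the `E_…` hypotheses below), never the truth of a field. [cite: Arthur2013, downstream register of the cell, hundred-and-twenty-seventh tranche (structure only)] -/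
structure Consumers127 where
  /-- C270 in arXiv v2 (2022-07-06; `arxiv-1810.03231v2/` under `HOME/pub-arthur-down-g53/primaries/`; dateline p0001:L1 "arXiv:1810.03231v2  [math.NT]  6 Jul 2022"; bib `HsiehYamana2024BesselPeriods`, Trans. Amer. Math. Soc. (2024), version of record not compared), Ming-Lun Hsieh – Shunsuke Yamana, THEOREM 2.5 AS PRINTED — the setting of §2.4: p0012:L19-23 "2.4.Hypotheses. We switch to the global setting. Let π≃ ⊗′ vπvbe a uni- tary irreduciblecuspidal temperedautomorphic represent ation of PGSp4(A) generated by a scalar valued degree two Siegel cuspidal Heck e eigenform f of weightκ≥2 and square-free paramodular level N." p0012:L24-27 "Fix an imaginary quadratic ﬁeld K. We decompose NasN=N+N−, where each prime factor of N+is split inKand each prime factor of N−is inert or ramiﬁed in K. We assume the following Heegner hypothesis : (Heeg) N−is the product of an even number of primes ." ((Q-ord) = the Klingen p-ordinary hypothesis of §1.4, p0004:L57-59); the statement: p0013:L19-21 "Theorem 2.5. Assume the hypotheses (Heeg) and ( Q-ord) are true for π, Kandp. Then there exist an explicitly given complex number Ωπ,N−∈C× and an element Θf∈oE/llbracketΓ−/rrbracketwith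 the following interpolation formula" [ν̂(Θ_f)² = Λ(1/2, Spn(π)_K ⊗ ν) / Ω_{π,N⁻} · e(π_p, ν_p)² · ν^{-1}(𝔑⁺₀) · α_P^6 × (the explicit constant in κ, w_K, Δ_K, ε_{N⁻}(f), N⁻) for every finite-order character ν̂ of Γ⁻, with the p-adic multiplier e(π_p, ν_p) displayed on p0013:L36-45]; abstract p0001:L4-7 "Abstract. We construct the anticyclotomic p-adicL-function that in- terpolates a square root of central values of twisted spinor L-functions of a quadratic base change of a Siegel cusp form of genus 2 with respect to a paramodular group of square-free level.". [cite: HsiehYamana2024BesselPeriods, Thm 2.5 (arXiv v2, p0013:L19-45) with §2.4 (p0012:L19-27)] -/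
  HYthetaV2gen : Prop
  /-- C270 in arXiv v2, THEOREM 1.4 AS PRINTED (the introduction's main theorem; `arxiv-1810.03231v2/`): p0005:L20-27 "Theorem 1.4. Assume that Nis square-free and that Kis split at each prime factor of N. Fix a decomposition NoK=N+ 0N+ 0. Ifπis tempered and (Q-ord) holds, then there is an element Θf∈oE/llbracketΓ−/rrbracketsuch that for every ﬁnite-order character ˆν: Γ−→¯Q× pwe have the following interpolation formula:" [the interpolation formula of Theorem 2.5 with N⁻ = 1, Ω_{π,1} = Λ(1, π, ad)/⟨f,f⟩_{K(N)} (p0005:L49-52)]; its relation to Theorem 2.5, Remark 1.5 (1): p0006:L2-8 "In Theorem 2.5, we actually constructs the theta element Θ f∈oE/llbracketΓ−/rrbracketunder the following Heegner hypothesis : (Heeg) N−is the product of an even number of primes . If(Heeg) isnottrue, then L(1 2,Spn(π)K⊗ν) = 0(seeRemark2.6(2)). Theorem 1.4 is its special case where N=N+andN−= 1." [cite: HsiehYamana2024BesselPeriods, Thm 1.4 (arXiv v2, p0005:L20-52), Rem. 1.5 (1) (p0006:L2-8)] -/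
  HYthetaV2 : Prop
  /-- HYPOTHESIS NODE (row C270 in arXiv v2; no supplier in print): MULTIPLICITY ONE FOR THE CUSPIDAL SPECTRUM OF THE INNER FORM PGU^D_2 (D the indefinite quaternion algebra over ℚ ramified exactly at the prime factors of N⁻, p0012:L28-30), as §9.1 assumes it for the space V realising π (`arxiv-1810.03231v2/`): p0047:L5-10 "Letπ≃ ⊗′ vπvbe an irreducible admissible representation of PGUD 2(AF) whichisrealizedonasubspace VofAcusp(PGUD 2). Thespace Acusp(PGSp4) satisﬁes multiplicity one thanks to the work of Arthur." — followed by the sentence p0047:L10-12 (verbatim in the comment lines below: it names a conj.) that the multiplicity one of 𝒜_cusp(PGU^D_2) is conj.d in general and is ASSUMED; the node is that assumption (for D split it is the book's multiplicity one for PGSp4 ≅ SO(3,2), which the text takes from « the work of Arthur »).  The use: p0047:L13-15 "Then since πv≃π∨ vfor everyv, we haveV=¯V:={¯φ|φ∈V}. Thus the restriction of the pairing ⟨,⟩toV×Vis nondegenerate." [cite: HsiehYamana2024BesselPeriods, §9.1 (arXiv v2, p0047:L5-14)] -/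
  HYmultOneD : Prop
  /-- HYPOTHESIS NODE (row C82 in arXiv v5; `arxiv-1802.08537v5/` under `HOME/pub-arthur-down-g53/primaries/`): THE HYPOTHESIS OF THEOREMS 1.1 / 1.2 — for the π there (cuspidal on GSp4(𝔸_ℚ), π_∞ a holomorphic discrete series or limit of discrete series), the weak functorial lift of π to GL4 EXISTS (and is cuspidal — the part the text equates with « not CAP or endoscopic »): p0001:L29-34 "The automorphic representations πin the statement of the theorem are exactly those that arise from classical genus 2vector-valued Siegel modular forms. The assumption that th e functorial lift is cuspidal amounts to demanding that πarises from a Siegel modular form that is not CAP or endoscopic; in these cases, the associated Galois repres entation is known to be reducible. In general, the existence of this lift follows from Arthur’s cl assiﬁcation [ Art13 ]; see Section 2.4for further discussion."; §2.4 « Arthur's classification »: p0005:L46-52 "Ifπis cohomological, then Weissauer [ Wei08 , Thm. 1.1] has shown that πis weakly equivalent to a globally generic automorphic representation of GSp4(AQ). Combined with the result of Asgari–Shahidi, we obtain a weak lift of πtoGL4. In particular, the results of this paper apply unconditionally to cohomological Siegel modular forms. More generally, the existence of a lift to GL4follows from Arthur’s endoscopic classiﬁcation [Art13 ]. Indeed,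 the case of PGSp4, i.e. where πhas trivial central character, has been spelled out in detail in [ Art04 ], and this work has been generalised by Gee–Taïbi [ GT19 ] to cover all" p0006:L1-3 "automorphic representations of GSp4. However, these works are all dependent on several papers that have been announced, but have yet to appear: see the disc ussions in [ GT19 , pp. 3] and in [Mok14 , pp. 527]." ([Art13] = the book, [Art04] = Arthur's 2004 GSp(4) note, [GT19] = row A4 `Consumers.GeeTaibi`, [Mok14] = row C191 `Consumers28.MokGSp4`; bibliography in the comment lines). [cite: WeissAriel2022Images, Thms 1.1/1.2 hypothesis, §1 (arXiv v5, p0001:L29-34), §2.4 (p0005:L46-52, p0006:L1-3)] -/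
  WeissLiftGL4 : Prop
  /-- C82 in arXiv v5 (2021-12-09; `arxiv-1802.08537v5/`, dateline p0001:L1-2 "arXiv:1802.08537v5  [math.NT]  9 Dec 2021ON THE IMAGES OF GALOIS REPRESENTATIONS ATTACHED TO LOW WEIGHT SIEGEL MODULAR FORMS"; bib `WeissAriel2022Images`, J. Lond. Math. Soc. (2) 106 (2022) 358–387, version of record not compared), Ariel Weiss, THEOREMS 1.1 AND 1.2 AS PRINTED (conditional in form — their common hypothesis is the node `WeissLiftGL4`): p0001:L20-28 "Theorem 1.1. Letπbe a cuspidal automorphic representation of GSp4(AQ)such thatπ∞is a holomorphic discrete series or limit of discrete series re presentation. Assume that the weak functorial lift of πtoGL4exists and is cuspidal. Let Ebe the coeﬃcient ﬁeld of π. For each primeλofE, of residue characteristic ℓ, let ρλ: Gal(Q/Q)→GSp4(Eλ) be theλ-adic Galois representation associated to π. Then: (i)Ifρλ|Qℓis de Rham, and if ℓ≥5, thenρλis irreducible. (ii)ρλ|Qℓis crystalline for all λ|ℓfor a set of primes ℓof Dirichlet density 1. In particular, ρλis irreducible for all λ|ℓfor a set of primes ℓof Dirichlet density 1." p0002:L1-10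 "Theorem 1.2. Letπbe a cuspidal automorphic representation of GSp4(AQ)such thatπ∞is a holomorphic discrete series or limit of discrete series re presentation. Assume that the weak functorial lift of πtoGL4exists and is cuspidal. Let Ebe the coeﬃcient ﬁeld of π. For each primeλofE, of residue characteristic ℓ, letFλ=OE/λand let ρλ: Gal(Q/Q)→GSp4(Fλ) be the mod λGalois representation associated to π. LetLbe the set of primes λofEfor which ρλ|Qℓis crystalline. Then: (i)For all but ﬁnitely many primes λ∈L,ρλis irreducible. (ii)Ifπis neither an automorphic induction nor a symmetric cube lif t, then, for all but ﬁnitely many primes λ∈L, the image of ρλcontains Sp4(Fℓ)." (tranche 29's `Consumers29.WeissImages` is the 2018 text: Theorem A « not CAP or endoscopic … crystalline and l > 2k−1 », Theorem B). [cite: WeissAriel2022Images, Thms 1.1, 1.2 (arXiv v5, p0001:L20-28, p0002:L1-10)] -/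
  WeissImagesV5 : Prop

-- Verbatim lines kept out of the docstrings by the register's lint (sentences naming a conj., titles, bibliography).  C270, `arxiv-1810.03231v2/`:
--   the node's sentence, p0047:L10-12 "It is conjectured in general that Acusp(PGUD 2) satisﬁes multiplicity one, which we assume."
--   §1.3, p0004:L13-17 "1.3.The B¨ ocherer conjecture. We construct the anticyclotomic p-adic L-function attached to πoverKwith explicit evaluation formula for anticy- clotomic characters of ﬁnite order. The key ingredient of ou r construction is theB¨ ocherer conjecture [5], which is a special case of the reﬁned Gross- Prasad conjecture formulated by Yifeng Liu [26] in full gene rality." / p0004:L34-36 "Furusawa and Morimoto [15, Theorem 1.2] have rece ntly proved the B¨ ocherer conjecture. Theorem 1.2 (Furusawa-Morimoto) .Assume that πis tempered." ([5] = Böcherer, [26] = Y. Liu, Crelle 717 (2016), [15] below)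
--   §2.4 on (Böch) for the inner form, p0012:L38-41 "Furusawa and Morimoto [15] have established the B¨ ocherer conjecture more generally for GUD 2(see Theorem" [9.1).]
--   (JL) in v2, p0012:L50-59 "When N−̸= 1, we will make use of the inner form transfer on PGSp4established in [39, Theorem 11.4], namely Jacquet-Langlands correspondence between PGSp4 and PGUD 2(cf. [39, Proposition 12.3] and Remarks 4.3 and 5.1): (JL) The representation πDoccurs in the space of cusp forms on PGUD 2(A) with multiplicity one."
--   Remark 1.5 (2)–(3), p0006:L9-12 "(2) SinceendoscopicSiegel cuspformsofdegree2areneverp aramodular (cf. the proof of Proposition 12.3 of [39]), sπ= 1. (3) Ifκ >2 andπis not a Saito-Kurokawa lift, then πis tempered by Proposition 8.1 of [15]."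
--   Theorem 9.1's lead, p0047:L58-59 "A special case of [15, Theorem 1.2] is stated as follows: Theorem 9.1 (Furusawa-Morimoto) .Assume that πvis tempered for all v." / Remark 9.2 (2), p0048:L6-12 "(2) More generally, Furusawa and Morimoto [13, 14, 15] prove d the Liu’s conjecture for irreducible cuspidal tempered repres entations of SO(2n+ 1) and characters of SO(2). In the course of the proof they veriﬁed that πhas the weak lift Spn( π) to GL 2n(AF) and ob- tainL(s,π,ad) to be the symmetric square L-function of Spn( π), which is holomorphic and nonzero at s= 1, for the exterior square" [L-function of Spn(π) has a pole at s = 1.]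
--   Remark 2.6 (5), p0013:L63-65 "(5) IfConjectures9.4.2and9.5.4of[1]holdforGUD 2, then2ℓ(π)coincides with the order of S-group of the Arthur parameter of πD." ([1] = the book: p0058:L40-41 "[1] J. Arthur, The endoscopic classiﬁcation of representat ions. Orthogonal and symplec- tic groups, Amer. Math. Soc. Colloq. Publ. 61, xviii+590pp. Amer. Math. Soc.,")
--   bibliography [15] p0059:L17-19 "[15] M. Furusawa and K. Morimoto, On the Gross-Prasad conjec ture with its reﬁne- ment for (SO(5) ,SO(2)) and the generalized B¨ ocherer’s conjecture, prepri nt.arXiv: 2205.09503" (= row C226, bib `FurusawaMorimoto2024SO5`, Compositio Math. 160 (2024) 2115–2202) / [39] p0060:L18-19 "[39] M. R¨ osner and R. Weissauer, Global liftings between in ner forms of GSp(4), preprint. arXiv: 2103.14715." (= rows C18 / E4, bib `RosnerWeissauer2024`,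
--   J. Number Theory 263 (2024) 79–138).
--   The 2018 text typed in tranche 105 (corpus TeX `paper-arxiv-1810.03231`, quoted there): Theorem 1.2's hypothesis line « Assume the hypotheses (Heeg), (JL), (Böch) and ($\calq$) are true for $\pi$, $K$, $p$
--   and $\nu$. », §1.3 (JL) p0004:L40-45 with « Since $\PGSp_4$ and $\PGU_2^D$ are isomorphic to special orthogonal groups, Arthur's project will establish this hypothesis. », §9.1 p0026:L71-72 — all three
--   absent from v2 as such: (JL) is supplied by [39], (Böch) by [15], the §9.1 sentence is unchanged.
-- C82, `arxiv-1802.08537v5/`: bibliography p0023:L10-11 "[Art13] ,The endoscopic classiﬁcation of representations , American Mathematical Society Collo- quium Publications, vol. 61, American Mathematical Societ y, Providence, RI, 2013. Orthogonal and" / p0023:L8-9 "[Art04] James Arthur, Automorphic representations of GSp(4) , Contributions to automorphic forms, geom- etry, and number theory, 2004, pp. 65–81. MR 2058604 ↑5" / p0023:L49-50 "[GT19] Toby Gee and Olivier Taïbi, Arthur’s multiplicity formula for GSp4and restriction to Sp4, J. Éc. polytech. Math. 6(2019), 469–535. MR 3991897 ↑5,6" / p0024:L16-17 "[Mok14] Chung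 Pang Mok, Galois representations attached to automorphic forms on GL2over CM ﬁelds , Compos. Math. 150(2014), no. 4, 523–567. MR 3200667 ↑3,6,7,8,15".
-- C220, `arxiv-1302.6144v2/`: Theorem 5.19 as printed in v2, p0028:L50-51 "Theorem 5.19. Conjecture 5.10 is true for quasi-split classical groups as in (i), (ii) and (iii) of §4.2 (if Hypothesis 4.8 is assumed)." (verbatim = tranche 90's `STfiniteness` up to the renumbering (c:finiteness) → 5.10, (hypo:TwTF) → 4.8).

/-- C270 v2's THEOREM 2.5 ⇐ THE BOOK BY NAME ∧ ROW C226's THEOREM 1.2 ∧ THE NODE — the places (`arxiv-1810.03231v2/`): (i) §9.1 p0047:L8-10 "Thespace Acusp(PGSp4) satisﬁes multiplicity one thanks to the work of Arthur." [read: the work of Arthur] for 𝒜_cusp(PGSp4), no bibliography pointer at the sentence ([1] = the book in the references) ↦ `∀ N, ν.Everything N` (by-name convention, as tranche 105); (ii) (Böch), the central-value formula behind the theta element, is the text's Theorem 1.2 / Theorem 9.1 = « [15, Theorem 1.2] »: p0004:L34 "Furusawa and Morimoto [15, Theorem 1.2] have rece ntly proved" […] p0047:L58-59 "A special case of [15,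 Theorem 1.2] is stated as follows: Theorem 9.1 (Furusawa-Morimoto) .Assume that πvis tempered for all v." […] — [15] = arXiv:2205.09503 = row C226, its Theorem 1.2 = `Consumers89.FMrefined` (the refined formula for tempered π on every G_D; tranche 89's `E_FMrefined` ⇐ Mok ∧ C67 ∧ C24) ↦ `c₈₉.FMrefined`; (iii) the multiplicity-one assumption of §9.1 ↦ the node `HYmultOneD`; (iv) (JL) for N⁻ ≠ 1, p0012:L53-56 "we will make use of the inner form transfer on PGSp4established in [39, Theorem 11.4], namely Jacquet-Langlands correspondence between PGSp4 and PGUD 2(cf. [39, Proposition 12.3] and Remarks 4.3 and 5.1):" — [39] = Rösner – Weissauer = rows C18 / E4 of the census, an Arthur-independent published input (absorbed; no DAG premise), likewise Remark 1.5 (2) on s_π (« the proof of Proposition 12.3 of [39] »); (v) other inputs absorbed: Sugano, Liu's refined GGP formulation, Dickson – Pitale – Saha – Schmidt, the authors' explicit Bessel integrals (§§3–8).  Premises: book (all ranks, by name), C226's Theorem 1.2, the node. [cite: HsiehYamana2024BesselPeriods, Thm 2.5 with §2.4 (p0012:L46-59), §9.1 (p0047:L5-14), Thm 9.1 (p0047:L58-59)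 (arXiv v2); FurusawaMorimoto2024SO5, Thm 1.2] -/
def E_HYthetaV2gen (ν : Nodes) (c₈₉ : Consumers89) (c₁₂₇ : Consumers127) : Prop :=
  (∀ N, ν.Everything N) → c₈₉.FMrefined → c₁₂₇.HYmultOneD → c₁₂₇.HYthetaV2gen

/-- C270 v2's THEOREM 1.4 ⇐ THE BOOK BY NAME ∧ ROW C226's THEOREM 1.2 — Theorem 1.4 is Theorem 2.5 with N = N⁺, N⁻ = 1 (p0006:L8 "Theorem 1.4 is its special case where N=N+andN−= 1.", `arxiv-1810.03231v2/`): then D is split (p0012:L28-30: D is ramified precisely at the prime factors of N⁻), PGU^D_2 = PGSp4, the multiplicity one §9.1 needs is the one the text takes from Arthur (p0047:L8-10), and (JL) is void (p0012:L53 « When N−̸= 1 »); (Böch) ↦ `c₈₉.FMrefined` as for Theorem 2.5.  Premises: book (by name), C226's Theorem 1.2; no node. [cite: HsiehYamana2024BesselPeriods, Thm 1.4 (arXiv v2, p0005:L20-27), Rem. 1.5 (1) (p0006:L2-8), §9.1 (p0047:L8-10); FurusawaMorimoto2024SO5, Thm 1.2] -/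
def E_HYthetaV2 (ν : Nodes) (c₈₉ : Consumers89) (c₁₂₇ : Consumers127) : Prop :=
  (∀ N, ν.Everything N) → c₈₉.FMrefined → c₁₂₇.HYthetaV2

/-- Theorem 1.4 as the special case N⁻ = 1 of Theorem 2.5, as Remark 1.5 (1) states it (`arxiv-1810.03231v2/` p0006:L8). [cite: HsiehYamana2024BesselPeriods, Rem. 1.5 (1) (arXiv v2, p0006:L8) (bookkeeping edge)] -/
def E_HYthetaV2special (c₁₂₇ : Consumers127) : Prop := c₁₂₇.HYthetaV2gen → c₁₂₇.HYthetaV2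

/-- THE NODE's PRINTED SUPPLIER FOR THE π OF ROW C82 ⇐ THE BOOK ∧ ROW A4, exactly as §2.4 of arXiv v5 names it (`arxiv-1802.08537v5/` p0005:L50-52, p0006:L1-3, quoted in the node's docstring: « follows from Arthur's endoscopic classification [Art13] … spelled out in detail in [Art04] … generalised by Gee–Taïbi [GT19] to cover all automorphic representations of GSp4 », with the flag « these works are all dependent on several papers that have been announced, but have yet to appear »).  [Art13] ↦ `∀ N, ν.Everything N`; [GT19] ↦ `Consumers.GeeTaibi` (row A4); [Art04] is the 2004 announcement the register resolves through the book and A4 (as tranche 29 did).  The cohomological case needs neither (Weissauer [Wei08] and Asgari – Shahidi, p0005:L46-49) — recorded, not a premise. [cite: WeissAriel2022Images, §2.4 (arXiv v5, p0005:L46-52, p0006:L1-3); GeeTaibi2019, Thm 7.4.1 (as typed in `Consumers.GeeTaibi`)] -/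
def E_WeissLiftGL4 (ν : Nodes) (c : Consumers) (c₁₂₇ : Consumers127) : Prop :=
  (∀ N, ν.Everything N) → c.GeeTaibi → c₁₂₇.WeissLiftGL4

/-- C82 v5's THEOREMS 1.1 / 1.2 ⇐ ROW C191 ∧ THE NODE — the places (`arxiv-1802.08537v5/`): the hypothesis of both theorems ↦ `WeissLiftGL4`; the Galois representations and local-global compatibility of §3 (Theorems 3.1 / 3.3, used in §§4–6): p0007:L10-17 "•The second construction, due to Sorensen [ Sor10], utilises the transfer map from GSp4toGL4 in combination with Harris–Taylor’s construction of Galoi s representations for automorphic representations of GL4, which uses unitary Shimura varieties [ HT01]. Sorensen’s costruction works in the more general setting of automorphic representa tionsπofGSp4(AF), withF totally real, so long as there exists a weak functorial lift o fπtoGL4. For cohomological automorphic representations of GSp4(AQ), the existence of this lift is due to Weissauer [ Wei08 , Thm. 1]. Using this construction, Mok [ Mok14 , Thm. 3.5] proves local-global compatibility at ramiﬁed primes." and p0008:L11-17 "•A second construction, due to Mok [ Mok14 ], extends the work of Sorensen [ Sor10] and con- structs an eigencurve for GSp4. As in the cohomological case, this construction generalis es to automorphic representations of GSp4over totally real ﬁelds.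 However, the construction only requires the existence of a functorial lift from GSp4toGL4for cohomological forms, so the construction is still unconditional for automorphic repre sentations of GSp4(AQ). Using this construction, Mok [ Mok14 , Thm. 3.5] proves local-global compatibility at ramiﬁed pr imes up to semisimpliﬁcation." — [Mok14] = row C191 `Consumers28.MokGSp4` (Compos. Math. 150 (2014); tranche 28's `E_MokGSp4` ⇐ book ∧ A4 from Mok's own text) ↦ `c₂₈.MokGSp4`; the v5 sentence that over ℚ this construction is unconditional is the author's and changes no edge of row C191 here.  Published Arthur-free inputs absorbed as in tranche 29 (Taylor, Laumon, Weissauer, Ramakrishnan, Jorza, Pan, Patrikis – Taylor, BLGGT, Gan – Takeda).  Premises: C191, the node. [cite: WeissAriel2022Images, Thms 1.1, 1.2, §3 (arXiv v5, p0007:L1-19, p0008:L3-19); Mok2014Compositio, Thm 3.5 (as cited)] -/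
def E_WeissImagesV5 (c₂₈ : Consumers28) (c₁₂₇ : Consumers127) : Prop :=
  c₂₈.MokGSp4 → c₁₂₇.WeissLiftGL4 → c₁₂₇.WeissImagesV5

/-- The hundred-and-twenty-seventh tranche of implications (row C270 v2: two edges and one bookkeeping edge over one node; row C82 v5: the node's supplier and one edge).
[cite: HsiehYamana2024BesselPeriods, Thms 1.4, 2.5, §9.1 (arXiv v2); WeissAriel2022Images, Thms 1.1, 1.2, §2.4 (arXiv v5) (each edge's source in its own docstring)] -/
structure Implications127 (ν : Nodes) (c : Consumers) (c₂₈ : Consumers28) (c₈₉ : Consumers89) (c₁₂₇ : Consumers127) : Prop where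
  hyV2gen : E_HYthetaV2gen ν c₈₉ c₁₂₇
  hyV2 : E_HYthetaV2 ν c₈₉ c₁₂₇
  hyV2special : E_HYthetaV2special c₁₂₇
  weissLift : E_WeissLiftGL4 ν c c₁₂₇
  weissV5 : E_WeissImagesV5 c₂₈ c₁₂₇

variable {c₁₉ : Consumers19} {c₂₈ : Consumers28} {c₂₉ : Consumers29} {c₆₇ : Consumers67} {c₈₉ : Consumers89} {c₁₀₅ : Consumers105} {c₁₂₇ : Consumers127}

/-- C270 v2's Theorem 2.5 given the book at all ranks, row C226's Theorem 1.2 and the node. [cite: HsiehYamana2024BesselPeriods, Thm 2.5 (arXiv v2) (bookkeeping proved here)] -/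
theorem hyThetaV2gen_of_book_C226_and_node (X : Implications127 ν c c₂₈ c₈₉ c₁₂₇) (hν : ∀ N, ν.Everything N) (hR : c₈₉.FMrefined) (hM : c₁₂₇.HYmultOneD) :
    c₁₂₇.HYthetaV2gen :=
  X.hyV2gen hν hR hM

/-- C270 v2's Theorem 1.4 given the book at all ranks and row C226's Theorem 1.2; no node. [cite: HsiehYamana2024BesselPeriods, Thm 1.4 (arXiv v2) (bookkeeping proved here)] -/
theorem hyThetaV2_of_book_and_C226 (X : Implications127 ν c c₂₈ c₈₉ c₁₂₇) (hν : ∀ N, ν.Everything N) (hR : c₈₉.FMrefined) : c₁₂₇.HYthetaV2 :=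
  X.hyV2 hν hR

/-- C270 v2's THEOREM 1.4 FROM THE INPUTS OF THE THREE DAGs: the book's 24 leaves (by name) and, through row C226's Theorem 1.2 (tranche 89's `fmRefined_of_inputs`: Mok ∧ rows C67 / C24
= Mok ∧ KMSW's proved scope), Mok's 29 leaves and KMSW's import-and-scope; NO hypothesis node — where the 2018 text needed (JL) and (Böch). [cite: HsiehYamana2024BesselPeriods, Thm 1.4 (arXiv v2);
FurusawaMorimoto2024SO5, Thm 1.2 (bookkeeping proved here)] [claim: KalethaMinguezShinWhite2014, under-review] -/
theorem hyThetaV2_of_inputs (X : Implications127 ν c c₂₈ c₈₉ c₁₂₇) (X₈₉ : Implications89 ν μ c c₈ c₃₄ c₈₉) (T : Implications34 μ κ c₃₃ c₃₄) (A : BookInputs ν)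
    (M : MokInputs μ) (K : KMSWInputs μ κ) : c₁₂₇.HYthetaV2 :=
  X.hyV2 A.everything (fmRefined_of_inputs X₈₉ T M K)

/-- C270 v2's THEOREM 2.5 FROM THE SAME INPUTS AND ITS ONE NODE (multiplicity one for the cuspidal spectrum of PGU^D_2). [cite: HsiehYamana2024BesselPeriods, Thm 2.5, §9.1 (arXiv v2) (bookkeeping proved here)] [claim: KalethaMinguezShinWhite2014, under-review] -/
theorem hyThetaV2gen_of_inputs_and_node (X : Implications127 ν c c₂₈ c₈₉ c₁₂₇) (X₈₉ : Implications89 ν μ c c₈ c₃₄ c₈₉) (T : Implications34 μ κ c₃₃ c₃₄) (A : BookInputs ν)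
    (M : MokInputs μ) (K : KMSWInputs μ κ) (hM : c₁₂₇.HYmultOneD) : c₁₂₇.HYthetaV2gen :=
  X.hyV2gen A.everything (fmRefined_of_inputs X₈₉ T M K) hM

/-- Theorem 1.4 through Theorem 2.5 (the bookkeeping edge): this road inherits the node, the direct edge does not — the register keeps both, as printed. [cite: HsiehYamana2024BesselPeriods, Rem. 1.5 (1) (arXiv v2) (bookkeeping proved here)] -/
theorem hyThetaV2_of_general (X : Implications127 ν c c₂₈ c₈₉ c₁₂₇) (hG : c₁₂₇.HYthetaV2gen) : c₁₂₇.HYthetaV2 :=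
  X.hyV2special hG

/-- C270 v2 IN CONDITIONAL FORM, 2026 (no status sentence in the v2 text beyond [read: thanks to the work of Arthur]): granting the book's, Mok's and KMSW's internal derivations, supply
edges and every PUBLISHED input, KMSW's import of Mok and the identification of the two copies of the general weighted fundamental lemma, and the rows' edges, Theorem 1.4 is
conditional on the book's AND Mok's 2024–2026 preprint layers and on the general and the non-standard weighted fundamental lemmas of both (the book by name; Mok through C226 ⇐
C67 ∧ C24); nothing of KMSW's unwritten sequels. [cite: HsiehYamana2024BesselPeriods, Thm 1.4 (arXiv v2) (bookkeeping proved here)] [claim: KalethaMinguezShinWhite2014, under-review] -/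
theorem hyThetaV2_conditional_form (X : Implications127 ν c c₂₈ c₈₉ c₁₂₇) (X₈₉ : Implications89 ν μ c c₈ c₃₄ c₈₉) (T : Implications34 μ κ c₃₃ c₃₄) (B : ν.BookEdges)
    (S : ν.SupplyEdges) (P : ν.PublishedLeaves) (D1 : KMSW2014.E_ImportMok μ κ) (D3 : KMSW2014.E_SameWFL μ κ) (MB : μ.SectionEdges) (MS : μ.SupplyEdges)
    (MP : μ.PublishedLeaves) (KB : κ.ChapterEdges) (KS : κ.SupplyEdges) (KP : κ.PublishedLeaves) :
    ν.PreprintLeaves2026 → ν.WFL_general → ν.WFL_nonstandard → μ.PreprintLeaves2026 → μ.WFL_general → μ.WFL_nonstandard → c₁₂₇.HYthetaV2 :=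
  fun hQ h6 h7 hMQ m6 m7 => hyThetaV2_of_inputs X X₈₉ T ⟨B, S, P, hQ, ⟨h6, h7⟩⟩ ⟨MB, MS, MP, hMQ, ⟨m6, m7⟩⟩ ⟨D1, KB, KS, KP, ⟨D3 m6⟩⟩

/-- ROW C270, THE TWO TEXT STATES SIDE BY SIDE: the 2018 text's Theorem 1.2 (tranche 105's `HYtheta`: the book's inputs AND the two hypothesis nodes (JL), (Böch)) and the 2022 text's
Theorem 1.4 (the book's inputs, Mok's and KMSW's proved scope through row C226, NO node) — the later text discharges in print what the earlier one assumed, at the price of Mok's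
leaves. [cite: HsiehYamana2024BesselPeriods, Thm 1.2 (2018 text) and Thm 1.4 (arXiv v2) (bookkeeping proved here)] [claim: KalethaMinguezShinWhite2014, under-review] -/
theorem c270_two_text_states (X₁₀₅ : Implications105 ν c₂ c₆₇ c₈₉ c₁₀₅) (X : Implications127 ν c c₂₈ c₈₉ c₁₂₇) (X₈₉ : Implications89 ν μ c c₈ c₃₄ c₈₉)
    (T : Implications34 μ κ c₃₃ c₃₄) (A : BookInputs ν) (M : MokInputs μ) (K : KMSWInputs μ κ) (hJ : c₁₀₅.HYjl) (hB : c₁₀₅.HYboch) :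
    c₁₀₅.HYtheta ∧ c₁₂₇.HYthetaV2 :=
  ⟨hyTheta_of_leaves_and_nodes X₁₀₅ A hJ hB, hyThetaV2_of_inputs X X₈₉ T A M K⟩

/-- The node of row C82 v5 from the book at all ranks and row A4 — its printed supplier. [cite: WeissAriel2022Images, §2.4 (arXiv v5) (bookkeeping proved here)] -/
theorem weissLiftGL4_of_book_and_A4 (X : Implications127 ν c c₂₈ c₈₉ c₁₂₇) (hν : ∀ N, ν.Everything N) (h₄ : c.GeeTaibi) : c₁₂₇.WeissLiftGL4 :=
  X.weissLift hν h₄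

/-- C82 v5's Theorems 1.1 / 1.2 given row C191 and the node. [cite: WeissAriel2022Images, Thms 1.1, 1.2 (arXiv v5) (bookkeeping proved here)] -/
theorem weissImagesV5_of_C191_and_node (X : Implications127 ν c c₂₈ c₈₉ c₁₂₇) (h₁₉₁ : c₂₈.MokGSp4) (hL : c₁₂₇.WeissLiftGL4) : c₁₂₇.WeissImagesV5 :=
  X.weissV5 h₁₉₁ hL

/-- C82 v5's THEOREMS 1.1 / 1.2 FROM THE BOOK's INPUTS: the node through its printed supplier (book ∧ A4, `geeTaibi_of_leaves`), row C191 through tranche 28's `mokGSp4_of_leaves`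
(book ∧ A4) — every leaf of the book, nothing of Mok's memoir or KMSW; the same support as tranche 29's reading of the 2018 text. [cite: WeissAriel2022Images, Thms 1.1, 1.2, §2.4 (arXiv v5)
(bookkeeping proved here)] -/
theorem weissImagesV5_of_leaves (X : Implications127 ν c c₂₈ c₈₉ c₁₂₇) (X₂₈ : Implications28 ν μ κ c c₁₉ c₂₈) (I : Implications ν μ κ c) (A : BookInputs ν) :
    c₁₂₇.WeissImagesV5 :=
  X.weissV5 (mokGSp4_of_leaves X₂₈ I A) (X.weissLift A.everything (geeTaibi_of_leaves I A))

/-- C82 v5 IN CONDITIONAL FORM, 2026, against its own §2.4 (« dependent on several papers that have been announced, but have yet to appear », 2021): granting the book's internal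
derivations, supply edges and every PUBLISHED input, Theorems 1.1 / 1.2 with their hypothesis supplied as printed are conditional on the book's 2024–2026 preprint layer and on the
general and the non-standard weighted fundamental lemmas. [cite: WeissAriel2022Images, §2.4 (arXiv v5, p0006:L1-3) (bookkeeping proved here)] -/
theorem weissImagesV5_conditional_form (X : Implications127 ν c c₂₈ c₈₉ c₁₂₇) (X₂₈ : Implications28 ν μ κ c c₁₉ c₂₈) (I : Implications ν μ κ c) (B : ν.BookEdges)
    (S : ν.SupplyEdges) (P : ν.PublishedLeaves) : ν.PreprintLeaves2026 → ν.WFL_general → ν.WFL_nonstandard → c₁₂₇.WeissImagesV5 :=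
  fun hQ h6 h7 => weissImagesV5_of_leaves X X₂₈ I ⟨B, S, P, hQ, ⟨h6, h7⟩⟩

/-- ROW C82, THE TWO TEXT STATES SIDE BY SIDE from the book's inputs: the 2018 text's Theorems A / B (tranche 29) and arXiv v5's Theorems 1.1 / 1.2 with their hypothesis supplied
as printed. [cite: WeissAriel2022Images, Thms A, B (2018 text) and Thms 1.1, 1.2 (arXiv v5) (bookkeeping proved here)] -/
theorem c82_two_text_states (W : Implications29 ν c c₁₉ c₂₈ c₂₉) (X : Implications127 ν c c₂₈ c₈₉ c₁₂₇) (X₂₈ : Implications28 ν μ κ c c₁₉ c₂₈) (I : Implications ν μ κ c)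
    (A : BookInputs ν) : c₂₉.WeissImages ∧ c₁₂₇.WeissImagesV5 :=
  ⟨weissImages_of_leaves W X₂₈ I A, weissImagesV5_of_leaves X X₂₈ I A⟩

/-- THE WHOLE HUNDRED-AND-TWENTY-SEVENTH TRANCHE FROM THE INPUTS OF THE THREE DAGs (KMSW in its proved scope), the earlier tranches' edges (89, 34, 28, 1) and C270 v2's one node:
C270 v2's Theorem 1.4 outright and Theorem 2.5 given the node; C82 v5's node and Theorems 1.1 / 1.2. [cite: HsiehYamana2024BesselPeriods, Thms 1.4, 2.5 (arXiv v2); WeissAriel2022Images,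
Thms 1.1, 1.2 (arXiv v5) (bookkeeping proved here)] [claim: KalethaMinguezShinWhite2014, under-review] -/
theorem hundredtwentyseventh_of_inputs (X : Implications127 ν c c₂₈ c₈₉ c₁₂₇) (X₈₉ : Implications89 ν μ c c₈ c₃₄ c₈₉) (T : Implications34 μ κ c₃₃ c₃₄)
    (X₂₈ : Implications28 ν μ κ c c₁₉ c₂₈) (I : Implications ν μ κ c) (A : BookInputs ν) (M : MokInputs μ) (K : KMSWInputs μ κ) :
    c₁₂₇.HYthetaV2 ∧ (c₁₂₇.HYmultOneD → c₁₂₇.HYthetaV2gen) ∧ c₁₂₇.WeissLiftGL4 ∧ c₁₂₇.WeissImagesV5 :=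
  ⟨hyThetaV2_of_inputs X X₈₉ T A M K, fun hM => hyThetaV2gen_of_inputs_and_node X X₈₉ T A M K hM,
    X.weissLift A.everything (geeTaibi_of_leaves I A), weissImagesV5_of_leaves X X₂₈ I A⟩

end Downstream

end Literature.NumberTheory.Automorphic.Arthur2013
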